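import Literature.Barriers.CriticalPhenomena.GaussianDominationRouteDiagramsProofs
import HarnessLib

/-!
# Towards `HvdH2017_prop74_holds` (Heydenreich–van der Hofstad, Prop. 7.4), II: the diagram
# algebra of §7.4–§7.5 over an abelian group, `ℝ≥0∞`-valued

Sibling proof file of `GaussianDominationRouteDiagrams.lean` (the named fact `HvdH2017_prop74`).
This file is the DIAGRAMMATIC half of the printed proof of Prop. 7.4 (HvdH §7.4 after BK, §7.5.1,
§7.5.2, Exercise 7.5), written — like `DiagramAlgebra` in `…DiagramsProofs.lean`, whose `convE` it
reuses — over an arbitrary abelian group `X` with `ℝ≥0∞`-valued line weights `T` (for `τ_p`), `Tt`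
(for `τ̃_p`) and `C` (for `[1 - cos(k·x)]`), so that Fubini and reindexing carry no summability
provisos. The diagram bounds `Δ_p, Δ̃_p, W_p(k), H_p(k), 2dp` enter as ARBITRARY upper bounds
`D, Dt, W, H, J₀` of the corresponding `ℝ≥0∞` expressions (`hD, hDt, hW, hH, hJ`).

* **Definitions** (7.4.2)–(7.4.4), (7.4.10): `A3, B1, B21, B22, B2`, the pair kernels `kB1, kB2`,
  the backward products `theta m` (`= (B₂B₁)^m A₃`, the book's `Ψ̄^{(m)}` (7.5.20)), the right-hand
  side `chainN n x` of (7.4.10) for `Π^{(n+1)}(x)`, the forward block `pushB` ((7.5.5)–(7.5.6)), the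
  masses `mass`, `bwd`.
* **(7.5.3)** (`tsum_chainN_le`, `tsum_chainN_le_closed`): `Σ_x chainN n x ≤ Δ (2Δ̃Δ)^{n+1}` from
  the forward block bound `fwd_block_le` ((7.5.12)–(7.5.14)) and the end bound `end_block_le` ((7.5.7)).
* **Split of cosines along the top of the diagram** (`thetaW`, `cos_split_theta`, `cos_split_chainN`):
  Lemma 7.3 with `J = 2n+3` pushed through the nesting by carrying the list of displacements already
  made; the side (`crd`) of the top line alternates after every `B₂` (§7.5.2).
* **The weighted terms** (`termA, termB, termW, midC` and their bounds `tsum_termA_le` …,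
  `sum_tsum_termW_le`, `tsum_cos_chainN_le`): left mass × middle sup × right (backward) mass, cases
  (a), (b), (c) of §7.5.2, with the backward masses bounded through Exercise 7.5 (`bwd_succ_le`,
  `bwd_block_le`, `bwd_le`; translation covariance `theta_shift`).
* **The estimates proper** (`endW_le` (7.5.16), `startW_le` (7.5.17), `midB_true_le` (7.5.21),
  `midB_false_le` (7.5.22)–(7.5.24), `midC_true_le`/`midC_false_le` (7.5.26)–(7.5.29), where the
  `B₂⁽²⁾` part of case (c) IS the diagram `Hat` = `H_p(a₁,a₂;k)` of (7.5.1)).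
* **Assembly** (`tsum_cos_chainN_le_closed`): `Σ_x C(x) chainN n x ≤ (2n+3)[2ΔΔ̃W P^n +
  (n+1)(1+J₀)Δ²W P^n + n(Δ̃²W + H)Δ² P^{n-1}]`, `P = 2Δ̃Δ` — (7.5.4) with `N = n + 1`.

Constants: the book bounds case (b) by `N[1+2dp]Δ²W P^{N-1}` (both parities at once) and case (a),
first line, "by symmetry"; here the first line is done by translation invariance (`startW_le`) and
the extra first-`B₁` term of the split (`termB ≤ Δ²W P^{N-1}`) is absorbed using `1 ≤ 1 + 2dp`, so the
printed constants come out exactly. The sibling `…Prop74.lean` instantiates `X = ℤ^d`, `T = τ_p`,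
`Tt = τ̃_p`, `C = [1-cos(k·)]` and converts to the real statement.

## References

* M. Heydenreich, R. van der Hofstad, *Progress in High-Dimensional Percolation and Random
  Graphs* (Springer 2017): (7.4.1)–(7.4.10), Prop. 7.4 ((7.5.3)–(7.5.4)), §7.5.1 ((7.5.5)–(7.5.14)),
  §7.5.2 ((7.5.15)–(7.5.29)), Exercise 7.5, Lemma 7.3.
-/

noncomputable section

namespace Literature.Barriers.CriticalPhenomena

namespace DiagramAlgebra

open scoped ENNReal

variable {X : Type*} [AddCommGroup X]

/-! #### The simple diagrams `A₃, B₁, B₂` of (7.4.2)–(7.4.4) and the chain (7.4.10) -/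

section Defs

variable (T Tt : X → ℝ≥0∞)

/-- `A₃(s,u,v) = τ(v-s) τ(u-s) τ(v-u)`. [cite: HeydenreichVanDerHofstad2017, (7.4.2)] -/
def A3 (s u v : X) : ℝ≥0∞ := T (v - s) * T (u - s) * T (v - u)

/-- `B₁(s,t,u,v) = τ̃(v-t) τ(u-s)`. [cite: HeydenreichVanDerHofstad2017, (7.4.3)] -/
def B1 (s t u v : X) : ℝ≥0∞ := Tt (v - t) * T (u - s)

/-- `B₂⁽¹⁾(u,v,s,t) = τ(v-u) τ(t-u) τ(s-v) τ(t-s)`. [cite: HeydenreichVanDerHofstad2017, (7.4.4)] -/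
def B21 (u v s t : X) : ℝ≥0∞ := T (v - u) * T (t - u) * T (s - v) * T (t - s)

/-- The triangle vertex `Σ_a τ(a-s) τ(u-a) τ(t-a)` of `B₂⁽²⁾`. [cite: HeydenreichVanDerHofstad2017, (7.4.4)] -/
def triV (s u t : X) : ℝ≥0∞ := ∑' a, T (a - s) * T (u - a) * T (t - a)

open Classical in
/-- `B₂⁽²⁾(u,v,s,t) = δ_{v,s} τ(t-u) Σ_a τ(a-s) τ(u-a) τ(t-a)`. [cite: HeydenreichVanDerHofstad2017, (7.4.4)] -/
def B22 (u v s t : X) : ℝ≥0∞ := (if v = s then 1 else 0) * T (t - u) * triV T s u t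

/-- `B₂ = B₂⁽¹⁾ + B₂⁽²⁾`. [cite: HeydenreichVanDerHofstad2017, (7.4.4)] -/
def B2 (u v s t : X) : ℝ≥0∞ := B21 T u v s t + B22 T u v s t

/-- The start of the chain, `A₃(0,u,w) = τ(u) τ(w) τ(u-w)` as a function of the pair `p = (w,u)`.
[cite: HeydenreichVanDerHofstad2017, (7.4.10)] -/
def sA3 (p : X × X) : ℝ≥0∞ := T p.2 * T p.1 * T (p.2 - p.1)

/-- `B₁` as a pair kernel `((w,u),(z,t)) ↦ B₁(w,u,z,t)`. [cite: HeydenreichVanDerHofstad2017, (7.4.10)] -/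
def kB1 (p q : X × X) : ℝ≥0∞ := B1 T Tt p.1 p.2 q.1 q.2

/-- `B₂` as a pair kernel `((z,t),(w,u)) ↦ B₂(z,t,w,u)`. [cite: HeydenreichVanDerHofstad2017, (7.4.10)] -/
def kB2 (p q : X × X) : ℝ≥0∞ := B2 T p.1 p.2 q.1 q.2

/-- **The backward products `Θ_m((z,t), x) = [(B₂B₁)^m A₃](z,t,x)`** of the chain (7.4.10) (the
`Ψ̄` of (7.5.20), read towards `x`): `Θ₀ = A₃(z,t,x)`,
`Θ_{m+1}((z,t),x) = Σ_{(w,u)} B₂(z,t,w,u) Σ_{(z',t')} B₁(w,u,z',t') Θ_m((z',t'),x)`.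
[cite: HeydenreichVanDerHofstad2017, (7.4.10) and (7.5.20)] -/
def theta : ℕ → X → X × X → ℝ≥0∞
  | 0, x, q => A3 T q.1 q.2 x
  | m + 1, x, p => ∑' q, kB2 T p q * ∑' r, kB1 T Tt q r * theta m x r

/-- **The right-hand side of (7.4.10) for `Π^{(n+1)}(x)`**:
`Σ_{(w,u)} A₃(0,u,w) Σ_{(z,t)} B₁(w,u,z,t) Θ_n((z,t),x)`. [cite: HeydenreichVanDerHofstad2017, (7.4.10)] -/
def chainN (n : ℕ) (x : X) : ℝ≥0∞ :=
  ∑' p, sA3 T p * ∑' q, kB1 T Tt p q * theta T Tt n x q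

/-- The mass `Σ_p F(p)` of a pair function. [folklore] -/
def mass (F : X × X → ℝ≥0∞) : ℝ≥0∞ := ∑' p, F p

/-- One forward block: `F'(r) = Σ_{p,q} F(p) B₁(p,q) B₂(q,r)` (the recursion (7.5.6) for `Ψ`).
[cite: HeydenreichVanDerHofstad2017, (7.5.5)–(7.5.6)] -/
def pushB (F : X × X → ℝ≥0∞) (r : X × X) : ℝ≥0∞ := ∑' p, ∑' q, F p * kB1 T Tt p q * kB2 T q r

/-- The backward mass `Σ_{a,x} Θ_m((0,a),x)` (the `Σ_{x,y} Ψ̄^{(m)}(x,y)` of Exercise 7.5).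
[cite: HeydenreichVanDerHofstad2017, Exercise 7.5] -/
def bwd (m : ℕ) : ℝ≥0∞ := ∑' a, ∑' x, theta T Tt m x (0, a)

end Defs

section Unfold

variable (T Tt : X → ℝ≥0∞)

/-- Unfolding lemma. [folklore] -/
theorem A3_def (s u v : X) : A3 T s u v = T (v - s) * T (u - s) * T (v - u) := rfl

/-- Unfolding lemma. [folklore] -/
theorem B1_def (s t u v : X) : B1 T Tt s t u v = Tt (v - t) * T (u - s) := rfl

/-- Unfolding lemma. [folklore] -/
theorem B21_def (u v s t : X) : B21 T u v s t = T (v - u) * T (t - u) * T (s - v) * T (t - s) := rfl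

/-- Unfolding lemma. [folklore] -/
theorem triV_def (s u t : X) : triV T s u t = ∑' a, T (a - s) * T (u - a) * T (t - a) := rfl

open Classical in
/-- Unfolding lemma. [folklore] -/
theorem B22_def (u v s t : X) :
    B22 T u v s t = (if v = s then 1 else 0) * T (t - u) * triV T s u t := rfl

/-- Unfolding lemma. [folklore] -/
theorem B2_def (u v s t : X) : B2 T u v s t = B21 T u v s t + B22 T u v s t := rfl

/-- Unfolding lemma. [folklore] -/
theorem sA3_def (p : X × X) : sA3 T p = T p.2 * T p.1 * T (p.2 - p.1) := rfl

/-- Unfolding lemma. [folklore] -/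
theorem kB1_def (p q : X × X) : kB1 T Tt p q = B1 T Tt p.1 p.2 q.1 q.2 := rfl

/-- Unfolding lemma. [folklore] -/
theorem kB2_def (p q : X × X) : kB2 T p q = B2 T p.1 p.2 q.1 q.2 := rfl

/-- Unfolding lemma. [folklore] -/
theorem theta_zero (x : X) (q : X × X) : theta T Tt 0 x q = A3 T q.1 q.2 x := rfl

/-- Unfolding lemma. [folklore] -/
theorem theta_succ (m : ℕ) (x : X) (p : X × X) :
    theta T Tt (m + 1) x p = ∑' q, kB2 T p q * ∑' r, kB1 T Tt q r * theta T Tt m x r := rfl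

/-- Unfolding lemma. [folklore] -/
theorem chainN_def (n : ℕ) (x : X) :
    chainN T Tt n x = ∑' p, sA3 T p * ∑' q, kB1 T Tt p q * theta T Tt n x q := rfl

omit [AddCommGroup X] in
/-- Unfolding lemma. [folklore] -/
theorem mass_def (F : X × X → ℝ≥0∞) : mass F = ∑' p, F p := rfl

/-- Unfolding lemma. [folklore] -/
theorem pushB_def (F : X × X → ℝ≥0∞) (r : X × X) :
    pushB T Tt F r = ∑' p, ∑' q, F p * kB1 T Tt p q * kB2 T q r := rfl

/-- Unfolding lemma. [folklore] -/
theorem bwd_def (m : ℕ) : bwd T Tt m = ∑' a, ∑' x, theta T Tt m x (0, a) := rfl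

end Unfold

/-! #### Reindexing tools -/

/-- `Σ_{(z,t)} f(z,t) = Σ_z Σ_a f(z, z + a)`. [folklore] -/
theorem tsum_prod_shift (f : X × X → ℝ≥0∞) : ∑' r : X × X, f r = ∑' z, ∑' a, f (z, z + a) := by
  rw [ENNReal.tsum_prod']
  exact tsum_congr fun z => ((Equiv.addLeft z).tsum_eq fun t => f (z, t)).symm

/-- `Σ_{p} f(p) = Σ_p f(p + (c,c))`. [folklore] -/
theorem tsum_pair_shift (f : X × X → ℝ≥0∞) (c : X) :
    ∑' p : X × X, f (p.1 + c, p.2 + c) = ∑' p : X × X, f p :=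
  (Equiv.prodCongr (Equiv.addRight c) (Equiv.addRight c)).tsum_eq f

/-! #### Fubini for the forward block and the mass recursion (7.5.11) -/

section Forward

variable (T Tt : X → ℝ≥0∞)

/-- `Σ_p F(p) Σ_q B₁(p,q) Σ_r B₂(q,r) G(r) = Σ_r F'(r) G(r)` with `F' = pushB F`. [folklore] -/
theorem tsum_push_block (F G : X × X → ℝ≥0∞) :
    ∑' p, F p * ∑' q, kB1 T Tt p q * ∑' r, kB2 T q r * G r = ∑' r, pushB T Tt F r * G r := by
  calc ∑' p, F p * ∑' q, kB1 T Tt p q * ∑' r, kB2 T q r * G r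
      = ∑' p, ∑' q, ∑' r, F p * kB1 T Tt p q * kB2 T q r * G r := by
        refine tsum_congr fun p => ?_
        rw [← ENNReal.tsum_mul_left]
        refine tsum_congr fun q => ?_
        rw [← mul_assoc, ← ENNReal.tsum_mul_left]
        exact tsum_congr fun r => by ring
    _ = ∑' p, ∑' r, ∑' q, F p * kB1 T Tt p q * kB2 T q r * G r :=
        tsum_congr fun p => ENNReal.tsum_comm
    _ = ∑' r, ∑' p, ∑' q, F p * kB1 T Tt p q * kB2 T q r * G r := ENNReal.tsum_comm
    _ = ∑' r, pushB T Tt F r * G r := by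
        refine tsum_congr fun r => ?_
        rw [pushB_def, ← ENNReal.tsum_mul_right]
        exact tsum_congr fun p => by rw [← ENNReal.tsum_mul_right]

/-- **(7.5.11)**: `Σ_r F'(r) ≤ (Σ_p F(p)) · sup_p Σ_{q,r} B₁(p,q) B₂(q,r)`.
[cite: HeydenreichVanDerHofstad2017, (7.5.11)] -/
theorem mass_pushB_le (F : X × X → ℝ≥0∞) {S : ℝ≥0∞}
    (hS : ∀ p, ∑' q, ∑' r, kB1 T Tt p q * kB2 T q r ≤ S) : mass (pushB T Tt F) ≤ mass F * S := by
  rw [mass_def, mass_def]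
  calc ∑' r, pushB T Tt F r = ∑' r, ∑' p, ∑' q, F p * kB1 T Tt p q * kB2 T q r := rfl
    _ = ∑' p, ∑' q, ∑' r, F p * kB1 T Tt p q * kB2 T q r := by
        rw [ENNReal.tsum_comm]
        exact tsum_congr fun p => ENNReal.tsum_comm
    _ = ∑' p, F p * ∑' q, ∑' r, kB1 T Tt p q * kB2 T q r := by
        refine tsum_congr fun p => ?_
        rw [← ENNReal.tsum_mul_left]
        refine tsum_congr fun q => ?_
        rw [← ENNReal.tsum_mul_left]
        exact tsum_congr fun r => by ring
    _ ≤ ∑' p, F p * S := ENNReal.tsum_le_tsum fun p => mul_le_mul' le_rfl (hS p)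
    _ = (∑' p, F p) * S := ENNReal.tsum_mul_right

/-- **(7.5.8)–(7.5.12), abstract form**: if every forward block is bounded by `S` and the end
`sup_p Σ_{q,x} B₁(p,q) A₃(q,x)` by `E`, then `Σ_x Σ_p F(p) Σ_q B₁(p,q) Θ_n(q,x) ≤ (Σ F) Sⁿ E`.
[cite: HeydenreichVanDerHofstad2017, (7.5.8)–(7.5.12)] -/
theorem tsum_chain_le_aux {S E : ℝ≥0∞} (hS : ∀ p, ∑' q, ∑' r, kB1 T Tt p q * kB2 T q r ≤ S)
    (hE : ∀ p, ∑' q, ∑' x, kB1 T Tt p q * A3 T q.1 q.2 x ≤ E) :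
    ∀ (n : ℕ) (F : X × X → ℝ≥0∞),
      ∑' x, ∑' p, F p * ∑' q, kB1 T Tt p q * theta T Tt n x q ≤ mass F * S ^ n * E
  | 0, F => by
    calc ∑' x, ∑' p, F p * ∑' q, kB1 T Tt p q * theta T Tt 0 x q
        = ∑' p, F p * ∑' q, ∑' x, kB1 T Tt p q * A3 T q.1 q.2 x := by
          rw [ENNReal.tsum_comm]
          refine tsum_congr fun p => ?_
          rw [ENNReal.tsum_mul_left, ENNReal.tsum_comm]
          rfl
      _ ≤ ∑' p, F p * E := ENNReal.tsum_le_tsum fun p => mul_le_mul' le_rfl (hE p)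
      _ = mass F * S ^ 0 * E := by rw [ENNReal.tsum_mul_right, pow_zero, mul_one, mass_def]
  | n + 1, F => by
    have e1 : ∀ x, ∑' p, F p * ∑' q, kB1 T Tt p q * theta T Tt (n + 1) x q =
        ∑' r, pushB T Tt F r * ∑' r', kB1 T Tt r r' * theta T Tt n x r' := fun x => by
      simp only [theta_succ]
      exact tsum_push_block T Tt F _
    calc ∑' x, ∑' p, F p * ∑' q, kB1 T Tt p q * theta T Tt (n + 1) x q
        = ∑' x, ∑' r, pushB T Tt F r * ∑' r', kB1 T Tt r r' * theta T Tt n x r' := tsum_congr e1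
      _ ≤ mass (pushB T Tt F) * S ^ n * E := tsum_chain_le_aux hS hE n _
      _ ≤ mass F * S * S ^ n * E := by gcongr; exact mass_pushB_le T Tt F hS
      _ = mass F * S ^ (n + 1) * E := by rw [pow_succ]; ring

/-- **(7.5.3), abstract form**: `Σ_x [rhs of (7.4.10) for Π^{(n+1)}] ≤ (Σ A₃(0,·,·)) Sⁿ E`.
[cite: HeydenreichVanDerHofstad2017, (7.5.3), (7.5.8)–(7.5.12)] -/
theorem tsum_chainN_le {S E : ℝ≥0∞} (hS : ∀ p, ∑' q, ∑' r, kB1 T Tt p q * kB2 T q r ≤ S)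
    (hE : ∀ p, ∑' q, ∑' x, kB1 T Tt p q * A3 T q.1 q.2 x ≤ E) (n : ℕ) :
    ∑' x, chainN T Tt n x ≤ mass (sA3 T) * S ^ n * E :=
  tsum_chain_le_aux T Tt hS hE n (sA3 T)

end Forward

/-! #### Translation invariance and the backward mass recursion (Exercise 7.5) -/

section Backward

variable (T Tt : X → ℝ≥0∞)

/-- `triV` is translation invariant. [folklore] -/
theorem triV_shift (s u t c : X) : triV T (s + c) (u + c) (t + c) = triV T s u t := by
  rw [triV_def, triV_def,
    ← (Equiv.addRight c).tsum_eq fun a => T (a - (s + c)) * T (u + c - a) * T (t + c - a)]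
  exact tsum_congr fun a => by
    simp only [Equiv.coe_addRight, add_sub_add_right_eq_sub]

/-- `B₁` is translation invariant. [folklore] -/
theorem kB1_shift (p q : X × X) (c : X) :
    kB1 T Tt (p.1 + c, p.2 + c) (q.1 + c, q.2 + c) = kB1 T Tt p q := by
  simp only [kB1_def, B1_def, add_sub_add_right_eq_sub]

/-- `B₂` is translation invariant. [folklore] -/
theorem kB2_shift (p q : X × X) (c : X) :
    kB2 T (p.1 + c, p.2 + c) (q.1 + c, q.2 + c) = kB2 T p q := by
  simp only [kB2_def, B2_def, B21_def, B22_def, add_sub_add_right_eq_sub, triV_shift]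
  congr 3
  by_cases h : p.2 = q.1
  · rw [if_pos h, if_pos (by rw [h])]
  · rw [if_neg h, if_neg (fun h' => h (add_right_cancel h'))]

/-- **Translation covariance of `Θ_m`**: `Θ_m((z+c, t+c), x) = Θ_m((z,t), x - c)`. [folklore] -/
theorem theta_shift : ∀ (m : ℕ) (x c : X) (q : X × X),
    theta T Tt m x (q.1 + c, q.2 + c) = theta T Tt m (x - c) q
  | 0, x, c, q => by
    simp only [theta_zero, A3_def]
    rw [show x - (q.1 + c) = x - c - q.1 by abel, show x - (q.2 + c) = x - c - q.2 by abel,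
      add_sub_add_right_eq_sub]
  | m + 1, x, c, p => by
    rw [theta_succ, theta_succ, ← tsum_pair_shift _ c]
    refine tsum_congr fun q => ?_
    rw [kB2_shift, ← tsum_pair_shift _ c]
    congr 1
    exact tsum_congr fun r => by rw [kB1_shift, theta_shift m x c r]

/-- `Σ_x Θ_m((z,t),x) = Σ_x Θ_m((0, t - z), x)`. [folklore] -/
theorem tsum_theta_eq (m : ℕ) (q : X × X) :
    ∑' x, theta T Tt m x q = ∑' x, theta T Tt m x (0, q.2 - q.1) := by
  have h : ∀ x, theta T Tt m x q = theta T Tt m (x - q.1) (0, q.2 - q.1) := fun x => by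
    rw [← theta_shift T Tt m x q.1 (0, q.2 - q.1)]
    simp only [zero_add, sub_add_cancel]
  rw [tsum_congr h]
  exact tsum_comp_sub_right (fun x => theta T Tt m x (0, q.2 - q.1)) q.1

/-- **The middle-sup lemma**: `Σ_x Σ_q M(q) Θ_m(q,x) ≤ (sup_a Σ_z M(z,z+a)) · Σ_{a,x} Θ_m((0,a),x)`.
[cite: HeydenreichVanDerHofstad2017, (7.5.21) and (7.5.27)] -/
theorem sum_MR_le (M : X × X → ℝ≥0∞) (m : ℕ) {S : ℝ≥0∞} (hS : ∀ a, ∑' z, M (z, z + a) ≤ S) :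
    ∑' x, ∑' q, M q * theta T Tt m x q ≤ S * bwd T Tt m := by
  calc ∑' x, ∑' q, M q * theta T Tt m x q = ∑' q, M q * ∑' x, theta T Tt m x q := by
        rw [ENNReal.tsum_comm]
        exact tsum_congr fun q => ENNReal.tsum_mul_left
    _ = ∑' q, M q * ∑' x, theta T Tt m x (0, q.2 - q.1) :=
        tsum_congr fun q => by rw [tsum_theta_eq]
    _ = ∑' z, ∑' a, M (z, z + a) * ∑' x, theta T Tt m x (0, a) := by
        rw [tsum_prod_shift]
        exact tsum_congr fun z => tsum_congr fun a => by simp only [add_sub_cancel_left]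
    _ = ∑' a, (∑' x, theta T Tt m x (0, a)) * ∑' z, M (z, z + a) := by
        rw [ENNReal.tsum_comm]
        refine tsum_congr fun a => ?_
        rw [← ENNReal.tsum_mul_left]
        exact tsum_congr fun z => mul_comm _ _
    _ ≤ ∑' a, (∑' x, theta T Tt m x (0, a)) * S :=
        ENNReal.tsum_le_tsum fun a => mul_le_mul' le_rfl (hS a)
    _ = S * bwd T Tt m := by rw [ENNReal.tsum_mul_right, bwd_def, mul_comm]

/-- **The left-mass × middle-sup × right-mass lemma**:
`Σ_x Σ_p F(p) Σ_q M(p,q) Θ_m(q,x) ≤ (Σ F) (sup_{p,a} Σ_z M(p,(z,z+a))) (Σ_{a,x} Θ_m((0,a),x))`.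
[cite: HeydenreichVanDerHofstad2017, (7.5.21) and (7.5.27)] -/
theorem sum_FMR_le (F : X × X → ℝ≥0∞) (M : X × X → X × X → ℝ≥0∞) (m : ℕ) {S : ℝ≥0∞}
    (hS : ∀ p a, ∑' z, M p (z, z + a) ≤ S) :
    ∑' x, ∑' p, F p * ∑' q, M p q * theta T Tt m x q ≤ mass F * S * bwd T Tt m := by
  calc ∑' x, ∑' p, F p * ∑' q, M p q * theta T Tt m x q
      = ∑' p, F p * ∑' x, ∑' q, M p q * theta T Tt m x q := by
        rw [ENNReal.tsum_comm]
        exact tsum_congr fun p => ENNReal.tsum_mul_left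
    _ ≤ ∑' p, F p * (S * bwd T Tt m) :=
        ENNReal.tsum_le_tsum fun p => mul_le_mul' le_rfl (sum_MR_le T Tt (M p) m (hS p))
    _ = mass F * S * bwd T Tt m := by rw [ENNReal.tsum_mul_right, mass_def, mul_assoc]

/-- `Σ_{a,x} Θ₀((0,a),x) = Δ(0)` (`= Σ_{a,x} τ(x) τ(a) τ(x-a)`). [cite: HeydenreichVanDerHofstad2017, (7.5.10)] -/
theorem bwd_zero (hTs : ∀ x, T (-x) = T x) : bwd T Tt 0 = convE (convE T T) T 0 := by
  rw [bwd_def, convE_def, ENNReal.tsum_comm]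
  refine tsum_congr fun x => ?_
  simp only [theta_zero, A3_def, sub_zero, convE_def, zero_sub, hTs]
  rw [← ENNReal.tsum_mul_right]
  exact tsum_congr fun a => by rw [← hTs (x - a), neg_sub]; ring

/-- **Exercise 7.5 (the backward recursion)**: `Σ_{a,x} Θ_{m+1}((0,a),x) ≤ S' Σ_{a,x} Θ_m((0,a),x)`
where `S'` bounds the backward blocks `sup_{a'} Σ_{z,a,q} B₂((0,a),q) B₁(q,(z,z+a'))`.
[cite: HeydenreichVanDerHofstad2017, Exercise 7.5 and (7.5.20)] -/
theorem bwd_succ_le (m : ℕ) {S' : ℝ≥0∞}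
    (hS' : ∀ a', ∑' z, ∑' a, ∑' q, kB2 T (0, a) q * kB1 T Tt q (z, z + a') ≤ S') :
    bwd T Tt (m + 1) ≤ S' * bwd T Tt m := by
  have e1 : bwd T Tt (m + 1) =
      ∑' x, ∑' r, (∑' a, ∑' q, kB2 T (0, a) q * kB1 T Tt q r) * theta T Tt m x r := by
    rw [bwd_def, ENNReal.tsum_comm]
    refine tsum_congr fun x => ?_
    calc ∑' a, theta T Tt (m + 1) x (0, a)
        = ∑' a, ∑' q, ∑' r, kB2 T (0, a) q * kB1 T Tt q r * theta T Tt m x r := by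
          refine tsum_congr fun a => ?_
          rw [theta_succ]
          refine tsum_congr fun q => ?_
          rw [← ENNReal.tsum_mul_left]
          exact tsum_congr fun r => by ring
      _ = ∑' a, ∑' r, ∑' q, kB2 T (0, a) q * kB1 T Tt q r * theta T Tt m x r :=
          tsum_congr fun a => ENNReal.tsum_comm
      _ = ∑' r, ∑' a, ∑' q, kB2 T (0, a) q * kB1 T Tt q r * theta T Tt m x r := ENNReal.tsum_comm
      _ = _ := by
          refine tsum_congr fun r => ?_
          rw [← ENNReal.tsum_mul_right]
          exact tsum_congr fun a => by rw [← ENNReal.tsum_mul_right]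
  rw [e1]
  exact sum_MR_le T Tt _ m hS'

end Backward


/-! #### Lemma 7.3 along the `2N+1` lines of the top of the diagram (§7.5.2) -/

section CosSplit

variable (T Tt C : X → ℝ≥0∞)

/-- The coordinate of a pair selected by the side of the top line (`false ↦` first, `true ↦` second).
[cite: HeydenreichVanDerHofstad2017, §7.5.2 ("the two factors of B₁ interchange top and bottom position")] -/
def crd : Bool → X × X → X
  | false, p => p.1
  | true, p => p.2

omit [AddCommGroup X] in
/-- Unfolding lemma. [folklore] -/
@[simp] theorem crd_false (p : X × X) : crd false p = p.1 := rfl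

omit [AddCommGroup X] in
/-- Unfolding lemma. [folklore] -/
@[simp] theorem crd_true (p : X × X) : crd true p = p.2 := rfl

/-- **The backward products with ONE weighted top line** (§7.5.2): `thetaW m j s x p` is
`Θ_m(p, x)` entered along the top at the side `s` of `p`, with the factor `[1 - cos(k·d_j)]` on
the `j`-th of its `2m+1` top lines (`j = 0`: the line of the first `B₂`, from `crd s p` to the
opposite side of the next pair; `j = 1`: the line of the first `B₁`, which keeps the side;
`j ≥ 2`: recursively; for `m = 0` the single line into `x`).
[cite: HeydenreichVanDerHofstad2017, §7.5.2 (cases (a)–(c))] -/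
def thetaW : ℕ → ℕ → Bool → X → X × X → ℝ≥0∞
  | 0, _, s, x => fun q => C (x - crd s q) * A3 T q.1 q.2 x
  | m + 1, 0, s, x => fun p =>
      ∑' q, C (crd (!s) q - crd s p) * kB2 T p q * ∑' r, kB1 T Tt q r * theta T Tt m x r
  | m + 1, 1, s, x => fun p =>
      ∑' q, kB2 T p q * ∑' r, C (crd (!s) r - crd (!s) q) * kB1 T Tt q r * theta T Tt m x r
  | m + 1, j + 2, s, x => fun p => ∑' q, kB2 T p q * ∑' r, kB1 T Tt q r * thetaW m j (!s) x r

/-- Unfolding lemma. [folklore] -/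
theorem thetaW_zero (j : ℕ) (s : Bool) (x : X) (q : X × X) :
    thetaW T Tt C 0 j s x q = C (x - crd s q) * A3 T q.1 q.2 x := by
  cases j <;> rfl

/-- Unfolding lemma. [folklore] -/
theorem thetaW_succ_zero (m : ℕ) (s : Bool) (x : X) (p : X × X) :
    thetaW T Tt C (m + 1) 0 s x p =
      ∑' q, C (crd (!s) q - crd s p) * kB2 T p q * ∑' r, kB1 T Tt q r * theta T Tt m x r := rfl

/-- Unfolding lemma. [folklore] -/
theorem thetaW_succ_one (m : ℕ) (s : Bool) (x : X) (p : X × X) :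
    thetaW T Tt C (m + 1) 1 s x p =
      ∑' q, kB2 T p q * ∑' r, C (crd (!s) r - crd (!s) q) * kB1 T Tt q r * theta T Tt m x r := rfl

/-- Unfolding lemma. [folklore] -/
theorem thetaW_succ_succ (m j : ℕ) (s : Bool) (x : X) (p : X × X) :
    thetaW T Tt C (m + 1) (j + 2) s x p =
      ∑' q, kB2 T p q * ∑' r, kB1 T Tt q r * thetaW T Tt C m j (!s) x r := rfl

omit [AddCommGroup X] in
/-- Linearity of a double `tsum` (sum). [folklore] -/
theorem tsum₂_add (f g : X × X → X × X → ℝ≥0∞) :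
    ∑' q, ∑' r, (f q r + g q r) = (∑' q, ∑' r, f q r) + ∑' q, ∑' r, g q r := by
  rw [← ENNReal.tsum_add]
  exact tsum_congr fun q => ENNReal.tsum_add

omit [AddCommGroup X] in
/-- Linearity of a double `tsum` (constant). [folklore] -/
theorem tsum₂_mul_left (a : ℝ≥0∞) (f : X × X → X × X → ℝ≥0∞) :
    ∑' q, ∑' r, a * f q r = a * ∑' q, ∑' r, f q r := by
  rw [← ENNReal.tsum_mul_left]
  exact tsum_congr fun q => ENNReal.tsum_mul_left

omit [AddCommGroup X] in
/-- A double `tsum` commutes with a finite sum. [folklore] -/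
theorem tsum₂_finset_sum (S : Finset ℕ) (f : ℕ → X × X → X × X → ℝ≥0∞) :
    ∑' q, ∑' r, ∑ j ∈ S, f j q r = ∑ j ∈ S, ∑' q, ∑' r, f j q r := by
  rw [← Summable.tsum_finsetSum fun _ _ => ENNReal.summable]
  exact tsum_congr fun q => Summable.tsum_finsetSum fun _ _ => ENNReal.summable

omit [AddCommGroup X] in
/-- Nesting a double `tsum`. [folklore] -/
theorem tsum_mul_tsum_eq (a : X × X → ℝ≥0∞) (b : X × X → X × X → ℝ≥0∞) :
    ∑' q, a q * ∑' r, b q r = ∑' q, ∑' r, a q * b q r :=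
  tsum_congr fun q => by rw [← ENNReal.tsum_mul_left]

/-- **Split of cosines along the top of `Θ_m`** (Lemma 7.3 pushed through the nesting): for a
list `L` of displacements already made,
`[1-cos(k·(ΣL + (x - crd s p)))] Θ_m(p,x) ≤ (|L| + 2m + 1) (Σ_{a∈L}[1-cos(k·a)] Θ_m(p,x) + Σ_{j ≤ 2m} Θ_m^{(j)}(p,x))`.
[cite: HeydenreichVanDerHofstad2017, Lemma 7.3 and §7.5.2] -/
theorem cos_split_theta (hCl : ∀ L : List X, C L.sum ≤ L.length * (L.map C).sum) :
    ∀ (m : ℕ) (s : Bool) (L : List X) (x : X) (p : X × X),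
      C (L.sum + (x - crd s p)) * theta T Tt m x p ≤
        (L.length + 2 * m + 1 : ℝ≥0∞) *
          ((L.map C).sum * theta T Tt m x p +
            ∑ j ∈ Finset.range (2 * m + 1), thetaW T Tt C m j s x p)
  | 0, s, L, x, p => by
    have h := hCl (L ++ [x - crd s p])
    simp only [List.sum_append, List.sum_singleton, List.length_append, List.length_singleton,
      List.map_append, List.map_cons, List.map_nil, Nat.cast_add, Nat.cast_one] at h
    simp only [Nat.cast_zero, mul_zero, add_zero, zero_add, Finset.range_one,
      Finset.sum_singleton, thetaW_zero, theta_zero]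
    calc C (L.sum + (x - crd s p)) * A3 T p.1 p.2 x
        ≤ (L.length + 1 : ℝ≥0∞) * ((L.map C).sum + C (x - crd s p)) * A3 T p.1 p.2 x :=
          mul_le_mul' h le_rfl
      _ = _ := by ring
  | m + 1, s, L, x, p => by
    set K : ℝ≥0∞ := (L.length + 2 * (m + 1 : ℕ) + 1 : ℝ≥0∞) with hK
    -- the pointwise bound for each `q, r`
    have key : ∀ q r : X × X,
        C (L.sum + (x - crd s p)) * (kB2 T p q * (kB1 T Tt q r * theta T Tt m x r)) ≤
          kB2 T p q * kB1 T Tt q r * (K *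
            (((L.map C).sum + C (crd (!s) q - crd s p) + C (crd (!s) r - crd (!s) q)) *
                theta T Tt m x r +
              ∑ j ∈ Finset.range (2 * m + 1), thetaW T Tt C m j (!s) x r)) := by
      intro q r
      have h := cos_split_theta hCl m (!s) (L ++ [crd (!s) q - crd s p, crd (!s) r - crd (!s) q]) x r
      have e1 : (L ++ [crd (!s) q - crd s p, crd (!s) r - crd (!s) q]).sum + (x - crd (!s) r) =
          L.sum + (x - crd s p) := by
        simp only [List.sum_append, List.sum_cons, List.sum_nil, add_zero]
        abel
      have e2 : ((L ++ [crd (!s) q - crd s p, crd (!s) r - crd (!s) q]).length + 2 * m + 1 : ℝ≥0∞) = K := by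
        simp only [hK, List.length_append, List.length_cons, List.length_nil, Nat.cast_add,
          Nat.cast_one]
        ring
      have e3 : ((L ++ [crd (!s) q - crd s p, crd (!s) r - crd (!s) q]).map C).sum =
          (L.map C).sum + C (crd (!s) q - crd s p) + C (crd (!s) r - crd (!s) q) := by
        simp only [List.map_append, List.map_cons, List.map_nil, List.sum_append, List.sum_cons,
          List.sum_nil, add_zero, add_assoc]
      rw [e1, e2, e3] at h
      calc C (L.sum + (x - crd s p)) * (kB2 T p q * (kB1 T Tt q r * theta T Tt m x r))
          = kB2 T p q * kB1 T Tt q r * (C (L.sum + (x - crd s p)) * theta T Tt m x r) := by ring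
        _ ≤ _ := mul_le_mul' le_rfl h
    -- summing up
    have lhs : C (L.sum + (x - crd s p)) * theta T Tt (m + 1) x p =
        ∑' q, ∑' r, C (L.sum + (x - crd s p)) * (kB2 T p q * (kB1 T Tt q r * theta T Tt m x r)) := by
      rw [theta_succ, ← ENNReal.tsum_mul_left]
      refine tsum_congr fun q => ?_
      rw [← ENNReal.tsum_mul_left, ← ENNReal.tsum_mul_left]
    have rhs : ∑' q, ∑' r, kB2 T p q * kB1 T Tt q r * (K *
            (((L.map C).sum + C (crd (!s) q - crd s p) + C (crd (!s) r - crd (!s) q)) *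
                theta T Tt m x r +
              ∑ j ∈ Finset.range (2 * m + 1), thetaW T Tt C m j (!s) x r)) =
        K * ((L.map C).sum * theta T Tt (m + 1) x p +
          ∑ j ∈ Finset.range (2 * (m + 1) + 1), thetaW T Tt C (m + 1) j s x p) := by
      have er : 2 * (m + 1) + 1 = 2 * m + 1 + 1 + 1 := by ring
      rw [er, Finset.sum_range_succ', Finset.sum_range_succ']
      simp only [zero_add, thetaW_succ_succ, thetaW_succ_zero, thetaW_succ_one, theta_succ,
        tsum_mul_tsum_eq]
      have step : ∀ q r : X × X, kB2 T p q * kB1 T Tt q r * (K *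
            (((L.map C).sum + C (crd (!s) q - crd s p) + C (crd (!s) r - crd (!s) q)) *
                theta T Tt m x r +
              ∑ j ∈ Finset.range (2 * m + 1), thetaW T Tt C m j (!s) x r)) =
          K * ((L.map C).sum * (kB2 T p q * (kB1 T Tt q r * theta T Tt m x r))) +
            (K * (kB2 T p q * (kB1 T Tt q r *
                ∑ j ∈ Finset.range (2 * m + 1), thetaW T Tt C m j (!s) x r)) +
              K * (kB2 T p q * (C (crd (!s) r - crd (!s) q) * kB1 T Tt q r * theta T Tt m x r)) +
              K * (C (crd (!s) q - crd s p) * kB2 T p q * (kB1 T Tt q r * theta T Tt m x r))) := by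
        intro q r
        ring
      have ej : ∑' q, ∑' r, kB2 T p q * (kB1 T Tt q r *
            ∑ j ∈ Finset.range (2 * m + 1), thetaW T Tt C m j (!s) x r) =
          ∑ j ∈ Finset.range (2 * m + 1),
            ∑' q, ∑' r, kB2 T p q * (kB1 T Tt q r * thetaW T Tt C m j (!s) x r) := by
        rw [← tsum₂_finset_sum]
        exact tsum_congr fun q => tsum_congr fun r => by rw [Finset.mul_sum, Finset.mul_sum]
      rw [show (∑' q, ∑' r, kB2 T p q * kB1 T Tt q r * (K *
            (((L.map C).sum + C (crd (!s) q - crd s p) + C (crd (!s) r - crd (!s) q)) *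
                theta T Tt m x r +
              ∑ j ∈ Finset.range (2 * m + 1), thetaW T Tt C m j (!s) x r))) =
          ∑' q, ∑' r, (K * ((L.map C).sum * (kB2 T p q * (kB1 T Tt q r * theta T Tt m x r))) +
            (K * (kB2 T p q * (kB1 T Tt q r *
                ∑ j ∈ Finset.range (2 * m + 1), thetaW T Tt C m j (!s) x r)) +
              K * (kB2 T p q * (C (crd (!s) r - crd (!s) q) * kB1 T Tt q r * theta T Tt m x r)) +
              K * (C (crd (!s) q - crd s p) * kB2 T p q * (kB1 T Tt q r * theta T Tt m x r))))
          from tsum_congr fun q => tsum_congr fun r => step q r]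
      rw [tsum₂_add, tsum₂_add, tsum₂_add, tsum₂_mul_left, tsum₂_mul_left, tsum₂_mul_left,
        tsum₂_mul_left, tsum₂_mul_left, ej]
      ring
    rw [lhs, ← rhs]
    exact ENNReal.tsum_le_tsum fun q => ENNReal.tsum_le_tsum fun r => key q r

end CosSplit


/-! #### The `2N+1` weighted terms and their bounds (§7.5.2, cases (a)–(c)) -/

section Terms

variable (T Tt C : X → ℝ≥0∞)

/-- Case (a), first line: `Σ_p [1-cos(k·u)] A₃(0,u,w) Σ_q B₁(p,q) Θ_n(q,x)`.
[cite: HeydenreichVanDerHofstad2017, §7.5.2 case (a)] -/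
def termA (n : ℕ) (x : X) : ℝ≥0∞ :=
  ∑' p, C p.2 * sA3 T p * ∑' q, kB1 T Tt p q * theta T Tt n x q

/-- Case (b), first `B₁`: `Σ_p A₃(0,u,w) Σ_q [1-cos(k·(t-u))] B₁(p,q) Θ_n(q,x)`.
[cite: HeydenreichVanDerHofstad2017, §7.5.2 case (b)] -/
def termB (n : ℕ) (x : X) : ℝ≥0∞ :=
  ∑' p, sA3 T p * ∑' q, C (q.2 - p.2) * kB1 T Tt p q * theta T Tt n x q

/-- The generic weighted term `Σ_p F(p) Σ_q B₁(p,q) Θ_n^{(j)}(q,x)` behind an initial pair function `F`.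
[cite: HeydenreichVanDerHofstad2017, §7.5.2] -/
def termW (F : X × X → ℝ≥0∞) (n j : ℕ) (s : Bool) (x : X) : ℝ≥0∞ :=
  ∑' p, F p * ∑' q, kB1 T Tt p q * thetaW T Tt C n j s x q

/-- The middle piece `B₁ B̃₂ B₁` of case (c): `Σ_{q,r} B₁(p,q) [1-cos(k·d)] B₂(q,r) B₁(r,r')`.
[cite: HeydenreichVanDerHofstad2017, (7.5.26)] -/
def midC (s : Bool) (p r' : X × X) : ℝ≥0∞ :=
  ∑' q, ∑' r, kB1 T Tt p q * (C (crd (!s) r - crd s q) * kB2 T q r) * kB1 T Tt r r'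

/-- Unfolding lemma. [folklore] -/
theorem termA_def (n : ℕ) (x : X) :
    termA T Tt C n x = ∑' p, C p.2 * sA3 T p * ∑' q, kB1 T Tt p q * theta T Tt n x q := rfl

/-- Unfolding lemma. [folklore] -/
theorem termB_def (n : ℕ) (x : X) :
    termB T Tt C n x = ∑' p, sA3 T p * ∑' q, C (q.2 - p.2) * kB1 T Tt p q * theta T Tt n x q := rfl

/-- Unfolding lemma. [folklore] -/
theorem termW_def (F : X × X → ℝ≥0∞) (n j : ℕ) (s : Bool) (x : X) :
    termW T Tt C F n j s x = ∑' p, F p * ∑' q, kB1 T Tt p q * thetaW T Tt C n j s x q := rfl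

/-- Unfolding lemma. [folklore] -/
theorem midC_def (s : Bool) (p r' : X × X) : midC T Tt C s p r' =
    ∑' q, ∑' r, kB1 T Tt p q * (C (crd (!s) r - crd s q) * kB2 T q r) * kB1 T Tt r r' := rfl

/-- **Lemma 7.3 at the top of the whole chain**:
`[1-cos(k·x)] · [rhs of (7.4.10)] ≤ (2n+3) (termA + termB + Σ_{j ≤ 2n} termW_j)`.
[cite: HeydenreichVanDerHofstad2017, Lemma 7.3 and §7.5.2] -/
theorem cos_split_chainN (hCl : ∀ L : List X, C L.sum ≤ L.length * (L.map C).sum) (n : ℕ) (x : X) :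
    C x * chainN T Tt n x ≤ (2 * n + 3 : ℝ≥0∞) * (termA T Tt C n x + termB T Tt C n x +
      ∑ j ∈ Finset.range (2 * n + 1), termW T Tt C (sA3 T) n j true x) := by
  set K : ℝ≥0∞ := (2 * n + 3 : ℝ≥0∞) with hK
  have key : ∀ p q : X × X, C x * (sA3 T p * (kB1 T Tt p q * theta T Tt n x q)) ≤
      sA3 T p * kB1 T Tt p q * (K * ((C p.2 + C (q.2 - p.2)) * theta T Tt n x q +
        ∑ j ∈ Finset.range (2 * n + 1), thetaW T Tt C n j true x q)) := by
    intro p q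
    have h := cos_split_theta T Tt C hCl n true [p.2, q.2 - p.2] x q
    have e1 : [p.2, q.2 - p.2].sum + (x - crd true q) = x := by
      simp only [List.sum_cons, List.sum_nil, add_zero, crd_true]
      abel
    have e2 : (([p.2, q.2 - p.2] : List X).length + 2 * n + 1 : ℝ≥0∞) = K := by
      simp only [hK, List.length_cons, List.length_nil]
      ring
    have e3 : (([p.2, q.2 - p.2] : List X).map C).sum = C p.2 + C (q.2 - p.2) := by
      simp only [List.map_cons, List.map_nil, List.sum_cons, List.sum_nil, add_zero]
    rw [e1, e2, e3] at h
    calc C x * (sA3 T p * (kB1 T Tt p q * theta T Tt n x q))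
        = sA3 T p * kB1 T Tt p q * (C x * theta T Tt n x q) := by ring
      _ ≤ _ := mul_le_mul' le_rfl h
  have lhs : C x * chainN T Tt n x = ∑' p, ∑' q, C x * (sA3 T p * (kB1 T Tt p q * theta T Tt n x q)) := by
    rw [chainN_def, ← ENNReal.tsum_mul_left]
    refine tsum_congr fun p => ?_
    rw [← ENNReal.tsum_mul_left, ← ENNReal.tsum_mul_left]
  have step : ∀ p q : X × X, sA3 T p * kB1 T Tt p q * (K * ((C p.2 + C (q.2 - p.2)) * theta T Tt n x q +
        ∑ j ∈ Finset.range (2 * n + 1), thetaW T Tt C n j true x q)) =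
      K * (C p.2 * sA3 T p * (kB1 T Tt p q * theta T Tt n x q)) +
        (K * (sA3 T p * (C (q.2 - p.2) * kB1 T Tt p q * theta T Tt n x q)) +
          K * (sA3 T p * (kB1 T Tt p q *
            ∑ j ∈ Finset.range (2 * n + 1), thetaW T Tt C n j true x q))) := fun p q => by ring
  have ej : ∑' p, ∑' q, sA3 T p * (kB1 T Tt p q *
        ∑ j ∈ Finset.range (2 * n + 1), thetaW T Tt C n j true x q) =
      ∑ j ∈ Finset.range (2 * n + 1), termW T Tt C (sA3 T) n j true x := by
    simp only [termW_def, tsum_mul_tsum_eq]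
    rw [← tsum₂_finset_sum]
    exact tsum_congr fun p => tsum_congr fun q => by rw [Finset.mul_sum, Finset.mul_sum]
  calc C x * chainN T Tt n x = _ := lhs
    _ ≤ ∑' p, ∑' q, sA3 T p * kB1 T Tt p q * (K * ((C p.2 + C (q.2 - p.2)) * theta T Tt n x q +
        ∑ j ∈ Finset.range (2 * n + 1), thetaW T Tt C n j true x q)) :=
        ENNReal.tsum_le_tsum fun p => ENNReal.tsum_le_tsum fun q => key p q
    _ = ∑' p, ∑' q, (K * (C p.2 * sA3 T p * (kB1 T Tt p q * theta T Tt n x q)) +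
        (K * (sA3 T p * (C (q.2 - p.2) * kB1 T Tt p q * theta T Tt n x q)) +
          K * (sA3 T p * (kB1 T Tt p q *
            ∑ j ∈ Finset.range (2 * n + 1), thetaW T Tt C n j true x q)))) :=
        tsum_congr fun p => tsum_congr fun q => step p q
    _ = K * (termA T Tt C n x + termB T Tt C n x +
        ∑ j ∈ Finset.range (2 * n + 1), termW T Tt C (sA3 T) n j true x) := by
        rw [tsum₂_add, tsum₂_add, tsum₂_mul_left, tsum₂_mul_left, tsum₂_mul_left, ej, termA_def,
          termB_def, tsum_mul_tsum_eq, tsum_mul_tsum_eq]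
        ring

/-- **Case (a), first line**: `Σ_x termA ≤ (sup_a Σ_{z,p} [1-cos] A₃ B₁) · Σ_{a,x} Θ_n`.
[cite: HeydenreichVanDerHofstad2017, (7.5.15)–(7.5.17)] -/
theorem tsum_termA_le (n : ℕ) {W8 : ℝ≥0∞}
    (hW8 : ∀ a, ∑' z, ∑' p, C p.2 * sA3 T p * kB1 T Tt p (z, z + a) ≤ W8) :
    ∑' x, termA T Tt C n x ≤ W8 * bwd T Tt n := by
  have e : ∀ x, termA T Tt C n x = ∑' q, (∑' p, C p.2 * sA3 T p * kB1 T Tt p q) * theta T Tt n x q :=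
    fun x => by
      rw [termA_def]
      calc ∑' p, C p.2 * sA3 T p * ∑' q, kB1 T Tt p q * theta T Tt n x q
          = ∑' p, ∑' q, C p.2 * sA3 T p * kB1 T Tt p q * theta T Tt n x q := by
            refine tsum_congr fun p => ?_
            rw [← ENNReal.tsum_mul_left]
            exact tsum_congr fun q => by ring
        _ = ∑' q, ∑' p, C p.2 * sA3 T p * kB1 T Tt p q * theta T Tt n x q := ENNReal.tsum_comm
        _ = _ := tsum_congr fun q => by rw [← ENNReal.tsum_mul_right]
  rw [tsum_congr e]
  exact sum_MR_le T Tt _ n hW8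

/-- **Case (b), first `B₁`**: `Σ_x termB ≤ (Σ A₃) (sup Σ_z [1-cos] B₁) Σ_{a,x} Θ_n`.
[cite: HeydenreichVanDerHofstad2017, (7.5.18)–(7.5.21)] -/
theorem tsum_termB_le (n : ℕ) {Wb1 : ℝ≥0∞}
    (hWb1 : ∀ (p : X × X) (a : X), ∑' z, C (z + a - p.2) * kB1 T Tt p (z, z + a) ≤ Wb1) :
    ∑' x, termB T Tt C n x ≤ mass (sA3 T) * Wb1 * bwd T Tt n := by
  have e : ∀ x, termB T Tt C n x =
      ∑' p, sA3 T p * ∑' q, (C (q.2 - p.2) * kB1 T Tt p q) * theta T Tt n x q := fun x => rfl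
  rw [tsum_congr e]
  exact sum_FMR_le T Tt (sA3 T) (fun p q => C (q.2 - p.2) * kB1 T Tt p q) n (fun p a => hWb1 p a)

/-- **Case (a), last line**: `Σ_x termW_F(0, j) ≤ (Σ F) · sup_p Σ_{q,x} B₁(p,q) [1-cos] A₃(q,x)`.
[cite: HeydenreichVanDerHofstad2017, (7.5.15)–(7.5.16)] -/
theorem tsum_termW_zero_le (F : X × X → ℝ≥0∞) (j : ℕ) (s : Bool) {Wa : ℝ≥0∞}
    (hWa : ∀ p, ∑' q, ∑' x, kB1 T Tt p q * (C (x - crd s q) * A3 T q.1 q.2 x) ≤ Wa) :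
    ∑' x, termW T Tt C F 0 j s x ≤ mass F * Wa := by
  calc ∑' x, termW T Tt C F 0 j s x
      = ∑' p, F p * ∑' q, ∑' x, kB1 T Tt p q * (C (x - crd s q) * A3 T q.1 q.2 x) := by
        simp only [termW_def, thetaW_zero]
        rw [ENNReal.tsum_comm]
        refine tsum_congr fun p => ?_
        rw [ENNReal.tsum_mul_left, ENNReal.tsum_comm]
    _ ≤ ∑' p, F p * Wa := ENNReal.tsum_le_tsum fun p => mul_le_mul' le_rfl (hWa p)
    _ = mass F * Wa := by rw [ENNReal.tsum_mul_right, mass_def]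

/-- **Case (c)**: `Σ_x termW_F(m+1, 0) ≤ (Σ F) (sup_{p,a} Σ_z midC(p,(z,z+a))) Σ_{a,x} Θ_m`.
[cite: HeydenreichVanDerHofstad2017, (7.5.26)–(7.5.29)] -/
theorem tsum_termW_succ_zero_le (F : X × X → ℝ≥0∞) (m : ℕ) (s : Bool) {Wc : ℝ≥0∞}
    (hWc : ∀ (p : X × X) (a : X), ∑' z, midC T Tt C s p (z, z + a) ≤ Wc) :
    ∑' x, termW T Tt C F (m + 1) 0 s x ≤ mass F * Wc * bwd T Tt m := by
  have e : ∀ x, termW T Tt C F (m + 1) 0 s x =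
      ∑' p, F p * ∑' r', midC T Tt C s p r' * theta T Tt m x r' := fun x => by
    rw [termW_def]
    refine tsum_congr fun p => ?_
    congr 1
    simp only [thetaW_succ_zero, midC_def]
    calc ∑' q, kB1 T Tt p q * ∑' r, C (crd (!s) r - crd s q) * kB2 T q r *
          ∑' r', kB1 T Tt r r' * theta T Tt m x r'
        = ∑' q, ∑' r, ∑' r', kB1 T Tt p q * (C (crd (!s) r - crd s q) * kB2 T q r) *
            kB1 T Tt r r' * theta T Tt m x r' := by
          refine tsum_congr fun q => ?_
          rw [← ENNReal.tsum_mul_left]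
          refine tsum_congr fun r => ?_
          rw [← ENNReal.tsum_mul_left, ← ENNReal.tsum_mul_left]
          exact tsum_congr fun r' => by ring
      _ = ∑' q, ∑' r', ∑' r, kB1 T Tt p q * (C (crd (!s) r - crd s q) * kB2 T q r) *
            kB1 T Tt r r' * theta T Tt m x r' := tsum_congr fun q => ENNReal.tsum_comm
      _ = ∑' r', ∑' q, ∑' r, kB1 T Tt p q * (C (crd (!s) r - crd s q) * kB2 T q r) *
            kB1 T Tt r r' * theta T Tt m x r' := ENNReal.tsum_comm
      _ = _ := by
          refine tsum_congr fun r' => ?_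
          rw [← ENNReal.tsum_mul_right]
          exact tsum_congr fun q => by rw [← ENNReal.tsum_mul_right]
  rw [tsum_congr e]
  exact sum_FMR_le T Tt F (midC T Tt C s) m hWc

/-- **Case (b)**: `Σ_x termW_F(m+1, 1) ≤ (Σ F) S (sup Σ_z [1-cos] B₁) Σ_{a,x} Θ_m`.
[cite: HeydenreichVanDerHofstad2017, (7.5.18)–(7.5.25)] -/
theorem tsum_termW_succ_one_le (F : X × X → ℝ≥0∞) (m : ℕ) (s : Bool) {S Wb : ℝ≥0∞}
    (hS : ∀ p, ∑' q, ∑' r, kB1 T Tt p q * kB2 T q r ≤ S)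
    (hWb : ∀ (r : X × X) (a : X), ∑' z, C (crd (!s) (z, z + a) - crd (!s) r) * kB1 T Tt r (z, z + a) ≤ Wb) :
    ∑' x, termW T Tt C F (m + 1) 1 s x ≤ mass F * S * Wb * bwd T Tt m := by
  have e : ∀ x, termW T Tt C F (m + 1) 1 s x = ∑' r, pushB T Tt F r *
      ∑' r', (C (crd (!s) r' - crd (!s) r) * kB1 T Tt r r') * theta T Tt m x r' := fun x => by
    rw [termW_def]
    simp only [thetaW_succ_one]
    exact tsum_push_block T Tt F _
  rw [tsum_congr e]
  calc _ ≤ mass (pushB T Tt F) * Wb * bwd T Tt m :=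
        sum_FMR_le T Tt (pushB T Tt F) (fun r r' => C (crd (!s) r' - crd (!s) r) * kB1 T Tt r r') m hWb
    _ ≤ mass F * S * Wb * bwd T Tt m := by gcongr; exact mass_pushB_le T Tt F hS

/-- The recursion `termW_F(m+1, j+2, s) = termW_{F'}(m, j, ¬s)` with `F' = pushB F`.
[cite: HeydenreichVanDerHofstad2017, (7.5.5)–(7.5.6)] -/
theorem termW_succ_succ (F : X × X → ℝ≥0∞) (m j : ℕ) (s : Bool) (x : X) :
    termW T Tt C F (m + 1) (j + 2) s x = termW T Tt C (pushB T Tt F) m j (!s) x := by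
  rw [termW_def, termW_def]
  simp only [thetaW_succ_succ]
  exact tsum_push_block T Tt F _

/-- The recursive bound `Bd` on `Σ_j Σ_x termW(m, j)` per unit of initial mass.
[cite: HeydenreichVanDerHofstad2017, §7.5.2] -/
def Bd (Wa Wb Wc : Bool → ℝ≥0∞) (S : ℝ≥0∞) : ℕ → Bool → ℝ≥0∞
  | 0, s => Wa s
  | m + 1, s => Wc s * bwd T Tt m + S * Wb (!s) * bwd T Tt m + S * Bd Wa Wb Wc S m (!s)

/-- Unfolding lemma. [folklore] -/
theorem Bd_zero (Wa Wb Wc : Bool → ℝ≥0∞) (S : ℝ≥0∞) (s : Bool) : Bd T Tt Wa Wb Wc S 0 s = Wa s := rfl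

/-- Unfolding lemma. [folklore] -/
theorem Bd_succ (Wa Wb Wc : Bool → ℝ≥0∞) (S : ℝ≥0∞) (m : ℕ) (s : Bool) :
    Bd T Tt Wa Wb Wc S (m + 1) s =
      Wc s * bwd T Tt m + S * Wb (!s) * bwd T Tt m + S * Bd T Tt Wa Wb Wc S m (!s) := rfl

/-- **All the weighted terms behind `F`**: `Σ_{j ≤ 2m} Σ_x termW_F(m, j, s) ≤ (Σ F) · Bd(m, s)`.
[cite: HeydenreichVanDerHofstad2017, §7.5.2 ((7.5.17), (7.5.25), (7.5.28)–(7.5.29))] -/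
theorem sum_tsum_termW_le {Wa Wb Wc : Bool → ℝ≥0∞} {S : ℝ≥0∞}
    (hS : ∀ p, ∑' q, ∑' r, kB1 T Tt p q * kB2 T q r ≤ S)
    (hWa : ∀ s p, ∑' q, ∑' x, kB1 T Tt p q * (C (x - crd s q) * A3 T q.1 q.2 x) ≤ Wa s)
    (hWb : ∀ s (r : X × X) (a : X), ∑' z, C (crd s (z, z + a) - crd s r) * kB1 T Tt r (z, z + a) ≤ Wb s)
    (hWc : ∀ s (p : X × X) (a : X), ∑' z, midC T Tt C s p (z, z + a) ≤ Wc s) :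
    ∀ (m : ℕ) (s : Bool) (F : X × X → ℝ≥0∞),
      ∑ j ∈ Finset.range (2 * m + 1), ∑' x, termW T Tt C F m j s x ≤ mass F * Bd T Tt Wa Wb Wc S m s
  | 0, s, F => by
    rw [Nat.mul_zero, Finset.sum_range_one, Bd_zero]
    exact tsum_termW_zero_le T Tt C F 0 s (hWa s)
  | m + 1, s, F => by
    have er : 2 * (m + 1) + 1 = 2 * m + 1 + 1 + 1 := by ring
    rw [er, Finset.sum_range_succ', Finset.sum_range_succ', Bd_succ]
    simp only [zero_add, termW_succ_succ]
    have h0 := tsum_termW_succ_zero_le T Tt C F m s (hWc s)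
    have h1 := tsum_termW_succ_one_le T Tt C F m s hS (hWb (!s))
    have h2 := sum_tsum_termW_le hS hWa hWb hWc m (!s) (pushB T Tt F)
    have hm := mass_pushB_le T Tt F hS
    calc ∑ j ∈ Finset.range (2 * m + 1), ∑' x, termW T Tt C (pushB T Tt F) m j (!s) x +
          ∑' x, termW T Tt C F (m + 1) 1 s x + ∑' x, termW T Tt C F (m + 1) 0 s x
        ≤ mass (pushB T Tt F) * Bd T Tt Wa Wb Wc S m (!s) + mass F * S * Wb (!s) * bwd T Tt m +
          mass F * Wc s * bwd T Tt m := add_le_add (add_le_add h2 h1) h0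
      _ ≤ mass F * S * Bd T Tt Wa Wb Wc S m (!s) + mass F * S * Wb (!s) * bwd T Tt m +
          mass F * Wc s * bwd T Tt m := by gcongr
      _ = _ := by ring

/-- **(7.5.4), abstract form**: `Σ_x [1-cos(k·x)] [rhs of (7.4.10)] ≤
(2n+3) (W₈ Σ Θ_n + (Σ A₃) W_b Σ Θ_n + (Σ A₃) Bd(n))`.
[cite: HeydenreichVanDerHofstad2017, Prop. 7.4 (7.5.4) and §7.5.2] -/
theorem tsum_cos_chainN_le (hCl : ∀ L : List X, C L.sum ≤ L.length * (L.map C).sum)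
    {Wa Wb Wc : Bool → ℝ≥0∞} {S W8 : ℝ≥0∞}
    (hS : ∀ p, ∑' q, ∑' r, kB1 T Tt p q * kB2 T q r ≤ S)
    (hWa : ∀ s p, ∑' q, ∑' x, kB1 T Tt p q * (C (x - crd s q) * A3 T q.1 q.2 x) ≤ Wa s)
    (hWb : ∀ s (r : X × X) (a : X), ∑' z, C (crd s (z, z + a) - crd s r) * kB1 T Tt r (z, z + a) ≤ Wb s)
    (hWc : ∀ s (p : X × X) (a : X), ∑' z, midC T Tt C s p (z, z + a) ≤ Wc s)
    (hW8 : ∀ a, ∑' z, ∑' p, C p.2 * sA3 T p * kB1 T Tt p (z, z + a) ≤ W8) (n : ℕ) :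
    ∑' x, C x * chainN T Tt n x ≤ (2 * n + 3 : ℝ≥0∞) *
      (W8 * bwd T Tt n + mass (sA3 T) * Wb true * bwd T Tt n + mass (sA3 T) * Bd T Tt Wa Wb Wc S n true) := by
  calc ∑' x, C x * chainN T Tt n x
      ≤ ∑' x, (2 * n + 3 : ℝ≥0∞) * (termA T Tt C n x + termB T Tt C n x +
          ∑ j ∈ Finset.range (2 * n + 1), termW T Tt C (sA3 T) n j true x) :=
        ENNReal.tsum_le_tsum fun x => cos_split_chainN T Tt C hCl n x
    _ = (2 * n + 3 : ℝ≥0∞) * (∑' x, termA T Tt C n x + ∑' x, termB T Tt C n x +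
          ∑ j ∈ Finset.range (2 * n + 1), ∑' x, termW T Tt C (sA3 T) n j true x) := by
        rw [ENNReal.tsum_mul_left, ENNReal.tsum_add, ENNReal.tsum_add,
          Summable.tsum_finsetSum fun _ _ => ENNReal.summable]
    _ ≤ _ := by
        gcongr
        · exact tsum_termA_le T Tt C n hW8
        · exact tsum_termB_le T Tt C n (fun p a => by
            have h := hWb true p a
            simpa only [crd_true] using h)
        · exact sum_tsum_termW_le T Tt C hS hWa hWb hWc n true (sA3 T)

end Terms


/-! #### The diagrammatic estimates proper: bounds on the blocks by `Δ_p, Δ̃_p` (§7.5.1, Exercise 7.5) -/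

section Estimates

variable {T Tt : X → ℝ≥0∞} {D Dt : ℝ≥0∞}

/-- `τ(y) ≤ (τ⋆τ)(y)` (`τ(0) = 1`). [cite: HeydenreichVanDerHofstad2017, §7.5 ("Δ_p is always larger than 1")] -/
theorem T_le_convE_T_T (hT0 : T 0 = 1) (y : X) : T y ≤ convE T T y := by
  have h := mul_le_convE T T y y
  rwa [sub_self, hT0, mul_one] at h

/-- `(τ⋆τ)(y) ≤ Δ`. [cite: HeydenreichVanDerHofstad2017, (7.2.1)] -/
theorem convE_T_T_le (hT0 : T 0 = 1) (hD : ∀ x, convE (convE T T) T x ≤ D) (y : X) :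
    convE T T y ≤ D := by
  have h := mul_le_convE (convE T T) T y y
  rw [sub_self, hT0, mul_one] at h
  exact h.trans (hD y)

/-- `(τ ⋆ (τ ⋆ τ̃))(y) ≤ Δ̃`. [cite: HeydenreichVanDerHofstad2017, (7.2.2)] -/
theorem convE_T_convE_T_Tt_le (hDt : ∀ x, convE (convE T T) Tt x ≤ Dt) (y : X) :
    convE T (convE T Tt) y ≤ Dt := by
  rw [← convE_assoc]; exact hDt y

/-- `(τ ⋆ τ̃)(y) ≤ Δ̃` (`τ ≤ τ⋆τ`). [cite: HeydenreichVanDerHofstad2017, (7.2.2)] -/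
theorem convE_T_Tt_le (hT0 : T 0 = 1) (hDt : ∀ x, convE (convE T T) Tt x ≤ Dt) (y : X) :
    convE T Tt y ≤ Dt :=
  (convE_mono (fun s => T_le_convE_T_T hT0 s) (fun _ => le_rfl) y).trans (hDt y)

/-- `Σ_y τ(y) (τ⋆τ)(y) = Δ(0)`. [cite: HeydenreichVanDerHofstad2017, (7.5.10)] -/
theorem tsum_T_mul_convE (hTs : ∀ x, T (-x) = T x) : ∑' y, T y * convE T T y = convE (convE T T) T 0 := by
  rw [convE_def]
  exact tsum_congr fun y => by rw [zero_sub, hTs, mul_comm]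

/-- `Σ_{t,c} τ(t) τ(c) τ(t-c) = Δ(0)`. [cite: HeydenreichVanDerHofstad2017, (7.5.10)] -/
theorem tsum_tsum_T3 (hTs : ∀ x, T (-x) = T x) :
    ∑' t, ∑' c, T t * T c * T (t - c) = convE (convE T T) T 0 := by
  rw [← tsum_T_mul_convE hTs]
  refine tsum_congr fun t => ?_
  rw [convE_def, ← ENNReal.tsum_mul_left]
  exact tsum_congr fun c => by ring

/-- `Σ_z τ̃(z + a - c) τ(z - w) = (τ ⋆ τ̃)(c - a - w)`. [folklore] -/
theorem tsum_Tt_T_eq_convE (hTts : ∀ x, Tt (-x) = Tt x) (a c w : X) :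
    ∑' z, Tt (z + a - c) * T (z - w) = convE T Tt (c - a - w) := by
  rw [← tsum_shift_mul_shift_eq_convE'' T hTts w (c - a)]
  exact tsum_congr fun z => by rw [mul_comm, show z + a - c = z - (c - a) by abel]

/-- `Σ_y τ(y) (τ⋆τ̃)(y - a) ≤ Δ̃`. [cite: HeydenreichVanDerHofstad2017, (7.5.14)] -/
theorem tsum_T_mul_G_le (hTs : ∀ x, T (-x) = T x) (hTts : ∀ x, Tt (-x) = Tt x)
    (hDt : ∀ x, convE (convE T T) Tt x ≤ Dt) (a : X) :
    ∑' y, T y * convE T Tt (y - a) ≤ Dt := by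
  have e : ∑' y, T y * convE T Tt (y - a) = convE T (convE T Tt) a := by
    rw [convE_def]
    exact tsum_congr fun y => by rw [← convE_neg hTs hTts (y - a), neg_sub]
  rw [e]
  exact convE_T_convE_T_Tt_le hDt a

/-- `Σ_{z,t} τ̃(t-u) τ(z-w) τ(t-z) ≤ Δ̃` (the `B₁` lines closed by one `τ`). [cite: HeydenreichVanDerHofstad2017, (7.5.13)] -/
theorem tsum_tsum_Tt_T_T_le (hTs : ∀ x, T (-x) = T x) (hDt : ∀ x, convE (convE T T) Tt x ≤ Dt) (w u : X) :
    ∑' z, ∑' t, Tt (t - u) * T (z - w) * T (t - z) ≤ Dt := by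
  rw [ENNReal.tsum_comm]
  calc ∑' t, ∑' z, Tt (t - u) * T (z - w) * T (t - z)
      = ∑' t, Tt (t - u) * convE T T (t - w) := by
        refine tsum_congr fun t => ?_
        rw [← tsum_shift_mul_shift_eq_convE' T T w t, ← ENNReal.tsum_mul_left]
        exact tsum_congr fun z => by ring
    _ = convE Tt (convE T T) (w - u) :=
        tsum_shift_mul_shift_eq_convE'' Tt (convE_neg hTs hTs) u w
    _ = convE (convE T T) Tt (w - u) := convE_comm _ _ _
    _ ≤ Dt := hDt _

omit [AddCommGroup X] in
/-- `Σ_a δ_{a,s} g(a) = g(s)` (for any decidability instances). [folklore] -/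
theorem tsum_delta_left (s : X) (g : X → ℝ≥0∞) {hdec : ∀ a, Decidable (a = s)} :
    ∑' a, (@ite _ (a = s) (hdec a) 1 0) * g a = g s := by
  rw [tsum_eq_single s fun a ha => by rw [if_neg ha, zero_mul], if_pos rfl, one_mul]

omit [AddCommGroup X] in
/-- `Σ_w δ_{t,w} g(w) = g(t)` (for any decidability instances). [folklore] -/
theorem tsum_delta_right (t : X) (g : X → ℝ≥0∞) {hdec : ∀ w, Decidable (t = w)} :
    ∑' w, (@ite _ (t = w) (hdec w) 1 0) * g w = g t := by
  rw [tsum_eq_single t fun w hw => by rw [if_neg (Ne.symm hw), zero_mul], if_pos rfl, one_mul]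

/-- **`Σ_{(w,u)} A₃(0,u,w) = Δ(0)`**. [cite: HeydenreichVanDerHofstad2017, (7.5.10)] -/
theorem mass_sA3_eq (hTs : ∀ x, T (-x) = T x) : mass (sA3 T) = convE (convE T T) T 0 := by
  rw [mass_def, ENNReal.tsum_prod', ENNReal.tsum_comm, ← tsum_tsum_T3 hTs]
  exact tsum_congr fun u => tsum_congr fun w => by rw [sA3_def]

open Classical in
/-- **(7.5.12)–(7.5.14): the forward block is at most `2 Δ̃ Δ`** (here `Δ Δ̃ + Δ Δ̃`, the two terms of `B₂`).
[cite: HeydenreichVanDerHofstad2017, (7.5.12)–(7.5.14)] -/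
theorem fwd_block_le (hTs : ∀ x, T (-x) = T x) (hTts : ∀ x, Tt (-x) = Tt x)
    (hD : ∀ x, convE (convE T T) T x ≤ D) (hDt : ∀ x, convE (convE T T) Tt x ≤ Dt) (p : X × X) :
    ∑' q, ∑' r, kB1 T Tt p q * kB2 T q r ≤ D * Dt + D * Dt := by
  -- split the two terms of `B₂`
  have esplit : ∑' q, ∑' r, kB1 T Tt p q * kB2 T q r =
      (∑' q : X × X, kB1 T Tt p q * ∑' r : X × X, B21 T q.1 q.2 r.1 r.2) +
        ∑' q : X × X, kB1 T Tt p q * ∑' r : X × X, B22 T q.1 q.2 r.1 r.2 := by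
    rw [← ENNReal.tsum_add]
    refine tsum_congr fun q => ?_
    rw [← mul_add, ← ENNReal.tsum_add, ← ENNReal.tsum_mul_left]
    exact tsum_congr fun r => by rw [kB2_def, B2_def]
  rw [esplit]
  refine add_le_add ?_ ?_
  · -- (7.5.13)
    have h1 : ∀ q : X × X, ∑' r : X × X, B21 T q.1 q.2 r.1 r.2 ≤ T (q.2 - q.1) * D := by
      intro q
      rw [ENNReal.tsum_prod']
      calc ∑' w', ∑' u', B21 T q.1 q.2 w' u'
          = T (q.2 - q.1) * ∑' w', T (w' - q.2) * ∑' u', T (u' - q.1) * T (u' - w') := by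
            rw [← ENNReal.tsum_mul_left]
            refine tsum_congr fun w' => ?_
            rw [← ENNReal.tsum_mul_left, ← ENNReal.tsum_mul_left]
            exact tsum_congr fun u' => by rw [B21_def]; ring
        _ = T (q.2 - q.1) * ∑' w', T (w' - q.2) * convE T T (w' - q.1) := by
            congr 1
            exact tsum_congr fun w' => by rw [tsum_shift_mul_shift_eq_convE hTs T q.1 w']
        _ = T (q.2 - q.1) * convE T (convE T T) (q.1 - q.2) := by
            rw [tsum_shift_mul_shift_eq_convE'' T (convE_neg hTs hTs) q.2 q.1]
        _ ≤ T (q.2 - q.1) * D := by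
            refine mul_le_mul' le_rfl ?_
            rw [convE_comm]
            exact hD _
    calc ∑' q : X × X, kB1 T Tt p q * ∑' r : X × X, B21 T q.1 q.2 r.1 r.2
        ≤ ∑' q : X × X, kB1 T Tt p q * (T (q.2 - q.1) * D) :=
          ENNReal.tsum_le_tsum fun q => mul_le_mul' le_rfl (h1 q)
      _ = (∑' z, ∑' t, Tt (t - p.2) * T (z - p.1) * T (t - z)) * D := by
          rw [← ENNReal.tsum_mul_right, ENNReal.tsum_prod']
          refine tsum_congr fun z => ?_
          rw [← ENNReal.tsum_mul_right]
          exact tsum_congr fun t => by rw [kB1_def, B1_def]; ring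
      _ ≤ Dt * D := mul_le_mul' (tsum_tsum_Tt_T_T_le hTs hDt p.1 p.2) le_rfl
      _ = D * Dt := mul_comm _ _
  · -- (7.5.14)
    set f : X → ℝ≥0∞ := fun y => T y * convE T T y with hf
    have h2 : ∀ q : X × X, ∑' r : X × X, B22 T q.1 q.2 r.1 r.2 = ∑' a, T (a - q.2) * f (q.1 - a) := by
      intro q
      rw [ENNReal.tsum_prod', ENNReal.tsum_comm]
      calc ∑' u', ∑' w', B22 T q.1 q.2 w' u'
          = ∑' u', T (u' - q.1) * triV T q.2 q.1 u' := by
            refine tsum_congr fun u' => ?_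
            simp only [B22_def]
            calc ∑' w', (if q.2 = w' then 1 else 0) * T (u' - q.1) * triV T w' q.1 u'
                = ∑' w', (if q.2 = w' then 1 else 0) * (T (u' - q.1) * triV T w' q.1 u') :=
                  tsum_congr fun w' => by ring
              _ = T (u' - q.1) * triV T q.2 q.1 u' :=
                  tsum_delta_right q.2 fun w' => T (u' - q.1) * triV T w' q.1 u'
        _ = ∑' u', ∑' a, T (u' - q.1) * (T (a - q.2) * T (q.1 - a) * T (u' - a)) := by
            refine tsum_congr fun u' => ?_
            rw [triV_def, ← ENNReal.tsum_mul_left]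
        _ = ∑' a, T (a - q.2) * T (q.1 - a) * ∑' u', T (u' - q.1) * T (u' - a) := by
            rw [ENNReal.tsum_comm]
            refine tsum_congr fun a => ?_
            rw [← ENNReal.tsum_mul_left]
            exact tsum_congr fun u' => by ring
        _ = ∑' a, T (a - q.2) * f (q.1 - a) := by
            refine tsum_congr fun a => ?_
            rw [tsum_shift_mul_shift_eq_convE hTs T q.1 a, hf]
            simp only
            rw [← convE_neg hTs hTs (a - q.1), neg_sub, mul_assoc]
    have hfsum : ∑' y, f y ≤ D := by rw [hf]; simp only; rw [tsum_T_mul_convE hTs]; exact hD 0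
    calc ∑' q : X × X, kB1 T Tt p q * ∑' r : X × X, B22 T q.1 q.2 r.1 r.2
        = ∑' z, ∑' t, ∑' a, Tt (t - p.2) * T (z - p.1) * (T (a - t) * f (z - a)) := by
          rw [ENNReal.tsum_prod']
          refine tsum_congr fun z => tsum_congr fun t => ?_
          rw [h2, kB1_def, B1_def, ← ENNReal.tsum_mul_left]
      _ = ∑' z, ∑' t, ∑' y, Tt (t - p.2) * T (z - p.1) * (T (z - y - t) * f y) := by
          refine tsum_congr fun z => tsum_congr fun t => ?_
          rw [← tsum_comp_sub_left (fun a => Tt (t - p.2) * T (z - p.1) * (T (a - t) * f (z - a))) z]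
          exact tsum_congr fun y => by rw [sub_sub_cancel]
      _ = ∑' z, ∑' y, ∑' t, Tt (t - p.2) * T (z - p.1) * (T (z - y - t) * f y) :=
          tsum_congr fun z => ENNReal.tsum_comm
      _ = ∑' y, ∑' z, ∑' t, Tt (t - p.2) * T (z - p.1) * (T (z - y - t) * f y) := ENNReal.tsum_comm
      _ = ∑' y, f y * ∑' z, T (z - p.1) * ∑' t, Tt (t - p.2) * T (z - y - t) := by
          refine tsum_congr fun y => ?_
          rw [← ENNReal.tsum_mul_left]
          refine tsum_congr fun z => ?_
          rw [← ENNReal.tsum_mul_left, ← ENNReal.tsum_mul_left]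
          exact tsum_congr fun t => by ring
      _ = ∑' y, f y * ∑' z, T (z - p.1) * convE Tt T (z - y - p.2) := by
          refine tsum_congr fun y => ?_
          congr 1
          exact tsum_congr fun z => by rw [tsum_shift_mul_shift_eq_convE' Tt T p.2 (z - y)]
      _ = ∑' y, f y * convE T (convE Tt T) (y + p.2 - p.1) := by
          refine tsum_congr fun y => ?_
          rw [← tsum_shift_mul_shift_eq_convE'' T (convE_neg hTts hTs) p.1 (y + p.2)]
          congr 1
          exact tsum_congr fun z => by rw [show z - y - p.2 = z - (y + p.2) by abel]
      _ ≤ ∑' y, f y * Dt := by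
          refine ENNReal.tsum_le_tsum fun y => mul_le_mul' le_rfl ?_
          have e : convE Tt T = convE T Tt := funext fun x => convE_comm _ _ _
          rw [e]
          exact convE_T_convE_T_Tt_le hDt _
      _ ≤ D * Dt := by rw [ENNReal.tsum_mul_right]; exact mul_le_mul' hfsum le_rfl


open Classical in
/-- **Exercise 7.5: the backward block is at most `2 Δ̃ Δ`** (`Δ Δ̃ + Δ Δ̃`).
[cite: HeydenreichVanDerHofstad2017, Exercise 7.5 and (7.5.20)] -/
theorem bwd_block_le (hTs : ∀ x, T (-x) = T x) (hTts : ∀ x, Tt (-x) = Tt x)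
    (hD : ∀ x, convE (convE T T) T x ≤ D) (hDt : ∀ x, convE (convE T T) Tt x ≤ Dt) (a' : X) :
    ∑' z, ∑' a, ∑' q, kB2 T (0, a) q * kB1 T Tt q (z, z + a') ≤ D * Dt + D * Dt := by
  set G : X → ℝ≥0∞ := convE T Tt with hG
  have hGs : ∀ x, G (-x) = G x := convE_neg hTs hTts
  -- `z` innermost, summed into `G`
  have e0 : ∑' z, ∑' a, ∑' q, kB2 T (0, a) q * kB1 T Tt q (z, z + a') =
      ∑' a, ∑' q : X × X, kB2 T (0, a) q * G (q.2 - a' - q.1) := by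
    calc ∑' z, ∑' a, ∑' q, kB2 T (0, a) q * kB1 T Tt q (z, z + a')
        = ∑' a, ∑' z, ∑' q, kB2 T (0, a) q * kB1 T Tt q (z, z + a') := ENNReal.tsum_comm
      _ = ∑' a, ∑' q, ∑' z, kB2 T (0, a) q * kB1 T Tt q (z, z + a') :=
          tsum_congr fun a => ENNReal.tsum_comm
      _ = _ := by
          refine tsum_congr fun a => tsum_congr fun q => ?_
          rw [ENNReal.tsum_mul_left, hG, ← tsum_Tt_T_eq_convE hTts a' q.2 q.1]
          exact congrArg _ (tsum_congr fun z => by rw [kB1_def, B1_def])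
  rw [e0]
  have esplit : ∑' a, ∑' q : X × X, kB2 T (0, a) q * G (q.2 - a' - q.1) =
      (∑' a, ∑' q : X × X, B21 T 0 a q.1 q.2 * G (q.2 - a' - q.1)) +
        ∑' a, ∑' q : X × X, B22 T 0 a q.1 q.2 * G (q.2 - a' - q.1) := by
    rw [← ENNReal.tsum_add]
    refine tsum_congr fun a => ?_
    rw [← ENNReal.tsum_add]
    exact tsum_congr fun q => by rw [kB2_def, B2_def, add_mul]
  rw [esplit]
  refine add_le_add ?_ ?_
  · -- the `B₂⁽¹⁾` part
    calc ∑' a, ∑' q : X × X, B21 T 0 a q.1 q.2 * G (q.2 - a' - q.1)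
        = ∑' a, ∑' s, ∑' t, T a * T (s - a) * (T t * T (t - s) * G (t - a' - s)) := by
          refine tsum_congr fun a => ?_
          rw [ENNReal.tsum_prod']
          exact tsum_congr fun s => tsum_congr fun t => by rw [B21_def, sub_zero, sub_zero]; ring
      _ = ∑' s, ∑' t, ∑' a, T a * T (s - a) * (T t * T (t - s) * G (t - a' - s)) := by
          rw [ENNReal.tsum_comm]
          exact tsum_congr fun s => ENNReal.tsum_comm
      _ = ∑' s, convE T T s * ∑' t, T t * T (t - s) * G (t - a' - s) := by
          refine tsum_congr fun s => ?_
          rw [convE_def, ← ENNReal.tsum_mul_left]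
          refine tsum_congr fun t => ?_
          rw [← ENNReal.tsum_mul_right]
      _ = ∑' s, convE T T s * ∑' y, T (y + s) * T y * G (y - a') := by
          refine tsum_congr fun s => ?_
          rw [← tsum_comp_add_right (fun t => T t * T (t - s) * G (t - a' - s)) s]
          congr 1
          exact tsum_congr fun y => by rw [add_sub_cancel_right, show y + s - a' - s = y - a' by abel]
      _ = ∑' s, ∑' y, convE T T s * (T (y + s) * T y * G (y - a')) :=
          tsum_congr fun s => by rw [← ENNReal.tsum_mul_left]
      _ = ∑' y, T y * G (y - a') * ∑' s, convE T T s * T (-y - s) := by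
          rw [ENNReal.tsum_comm]
          refine tsum_congr fun y => ?_
          rw [← ENNReal.tsum_mul_left]
          refine tsum_congr fun s => ?_
          rw [show y + s = -(-y - s) by abel, hTs]
          ring
      _ = ∑' y, T y * G (y - a') * convE (convE T T) T (-y) := by
          refine tsum_congr fun y => ?_
          rw [convE_def (convE T T)]
      _ ≤ ∑' y, T y * G (y - a') * D := ENNReal.tsum_le_tsum fun y => mul_le_mul' le_rfl (hD _)
      _ ≤ Dt * D := by
          rw [ENNReal.tsum_mul_right]
          exact mul_le_mul' (tsum_T_mul_G_le hTs hTts hDt a') le_rfl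
      _ = D * Dt := mul_comm _ _
  · -- the `B₂⁽²⁾` part
    calc ∑' a, ∑' q : X × X, B22 T 0 a q.1 q.2 * G (q.2 - a' - q.1)
        = ∑' a, ∑' s, ∑' t, (if a = s then 1 else 0) * (T t * triV T s 0 t * G (t - a' - s)) := by
          refine tsum_congr fun a => ?_
          rw [ENNReal.tsum_prod']
          exact tsum_congr fun s => tsum_congr fun t => by rw [B22_def, sub_zero]; ring
      _ = ∑' s, ∑' t, ∑' a, (if a = s then 1 else 0) * (T t * triV T s 0 t * G (t - a' - s)) := by
          rw [ENNReal.tsum_comm]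
          exact tsum_congr fun s => ENNReal.tsum_comm
      _ = ∑' s, ∑' t, T t * triV T s 0 t * G (t - a' - s) :=
          tsum_congr fun s => tsum_congr fun t => tsum_delta_left s _
      _ = ∑' s, ∑' t, ∑' c, T t * T c * T (t - c) * (T (c - s) * G (t - a' - s)) := by
          refine tsum_congr fun s => tsum_congr fun t => ?_
          rw [triV_def, ← ENNReal.tsum_mul_left, ← ENNReal.tsum_mul_right]
          exact tsum_congr fun c => by rw [zero_sub, hTs]; ring
      _ = ∑' t, ∑' c, ∑' s, T t * T c * T (t - c) * (T (c - s) * G (t - a' - s)) := by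
          rw [ENNReal.tsum_comm]
          exact tsum_congr fun t => ENNReal.tsum_comm
      _ = ∑' t, ∑' c, T t * T c * T (t - c) * convE T G (t - a' - c) := by
          refine tsum_congr fun t => tsum_congr fun c => ?_
          rw [ENNReal.tsum_mul_left, ← tsum_shift_mul_shift_eq_convE'' T hGs c (t - a')]
          congr 1
          exact tsum_congr fun s => by rw [← hTs (s - c), neg_sub, ← hGs (s - (t - a')),
            show -(s - (t - a')) = t - a' - s by abel]
      _ ≤ ∑' t, ∑' c, T t * T c * T (t - c) * Dt :=
          ENNReal.tsum_le_tsum fun t => ENNReal.tsum_le_tsum fun c =>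
            mul_le_mul' le_rfl (convE_T_convE_T_Tt_le hDt _)
      _ = (∑' t, ∑' c, T t * T c * T (t - c)) * Dt := by
          rw [← ENNReal.tsum_mul_right]
          exact tsum_congr fun t => ENNReal.tsum_mul_right
      _ ≤ D * Dt := by rw [tsum_tsum_T3 hTs]; exact mul_le_mul' (hD 0) le_rfl

/-- **(7.5.7): the end of the chain, `sup_p Σ_{q,x} B₁(p,q) A₃(q,x) ≤ Δ Δ̃`**.
[cite: HeydenreichVanDerHofstad2017, (7.5.7)–(7.5.8)] -/
theorem end_block_le (hT0 : T 0 = 1) (hTs : ∀ x, T (-x) = T x) (hTts : ∀ x, Tt (-x) = Tt x)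
    (hD : ∀ x, convE (convE T T) T x ≤ D) (hDt : ∀ x, convE (convE T T) Tt x ≤ Dt) (p : X × X) :
    ∑' q, ∑' x, kB1 T Tt p q * A3 T q.1 q.2 x ≤ D * Dt := by
  set f : X → ℝ≥0∞ := fun y => T y * convE T T y with hf
  have hfsum : ∑' y, f y ≤ D := by rw [hf]; simp only; rw [tsum_T_mul_convE hTs]; exact hD 0
  calc ∑' q, ∑' x, kB1 T Tt p q * A3 T q.1 q.2 x
      = ∑' z, ∑' t, Tt (t - p.2) * T (z - p.1) * f (t - z) := by
        rw [ENNReal.tsum_prod']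
        refine tsum_congr fun z => tsum_congr fun t => ?_
        rw [hf]
        simp only [kB1_def, B1_def, A3_def]
        rw [← tsum_shift_mul_shift_eq_convE hTs T z t, ← ENNReal.tsum_mul_left, ← ENNReal.tsum_mul_left]
        exact tsum_congr fun x => by ring
    _ = ∑' z, ∑' y, Tt (y + z - p.2) * T (z - p.1) * f y := by
        refine tsum_congr fun z => ?_
        rw [← tsum_comp_add_right (fun t => Tt (t - p.2) * T (z - p.1) * f (t - z)) z]
        exact tsum_congr fun y => by rw [add_sub_cancel_right]
    _ = ∑' y, f y * ∑' z, Tt (z + y - p.2) * T (z - p.1) := by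
        rw [ENNReal.tsum_comm]
        refine tsum_congr fun y => ?_
        rw [← ENNReal.tsum_mul_left]
        exact tsum_congr fun z => by rw [add_comm y z]; ring
    _ = ∑' y, f y * convE T Tt (p.2 - y - p.1) :=
        tsum_congr fun y => by rw [tsum_Tt_T_eq_convE hTts y p.2 p.1]
    _ ≤ ∑' y, f y * Dt := ENNReal.tsum_le_tsum fun y => mul_le_mul' le_rfl (convE_T_Tt_le hT0 hDt _)
    _ ≤ D * Dt := by rw [ENNReal.tsum_mul_right]; exact mul_le_mul' hfsum le_rfl

/-- `Σ_{a,x} Θ₀ ≤ Δ`. [cite: HeydenreichVanDerHofstad2017, (7.5.10)] -/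
theorem bwd_zero_le (hTs : ∀ x, T (-x) = T x) (hD : ∀ x, convE (convE T T) T x ≤ D) :
    bwd T Tt 0 ≤ D := by
  rw [bwd_zero T Tt hTs]; exact hD 0

/-- `Σ A₃(0,·,·) ≤ Δ`. [cite: HeydenreichVanDerHofstad2017, (7.5.10)] -/
theorem mass_sA3_le (hTs : ∀ x, T (-x) = T x) (hD : ∀ x, convE (convE T T) T x ≤ D) :
    mass (sA3 T) ≤ D := by
  rw [mass_sA3_eq hTs]; exact hD 0


/-! #### The weighted pieces: `W_p(k)` and `H_p(k)` (§7.5.2) -/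

/-- **`H_p(a₁,a₂;k)` (7.5.1), abstract**: `Σ_{u,v,s,t} [1-cos(k·(t-u))] B₁(0,a₁,u,s) B₂⁽²⁾(u,s,s,t) B₁(s,t,v,v+a₂)`.
[cite: HeydenreichVanDerHofstad2017, (7.5.1)] -/
def Hat (T Tt C : X → ℝ≥0∞) (a₁ a₂ : X) : ℝ≥0∞ :=
  ∑' u, ∑' v, ∑' s, ∑' t, C (t - u) * B1 T Tt 0 a₁ u s * B22 T u s s t * B1 T Tt s t v (v + a₂)

/-- Unfolding lemma. [folklore] -/
theorem Hat_def (T Tt C : X → ℝ≥0∞) (a₁ a₂ : X) : Hat T Tt C a₁ a₂ =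
    ∑' u, ∑' v, ∑' s, ∑' t, C (t - u) * B1 T Tt 0 a₁ u s * B22 T u s s t * B1 T Tt s t v (v + a₂) := rfl

variable {C : X → ℝ≥0∞} {W H J₀ : ℝ≥0∞} {Jf : X → ℝ≥0∞}

/-- **(7.5.16), case (a)**: `sup_p Σ_{q,x} B₁(p,q) [1-cos] A₃(q,x) ≤ Δ̃ W_p(k)` for either top line into `x`.
[cite: HeydenreichVanDerHofstad2017, (7.5.15)–(7.5.16)] -/
theorem endW_le (hTs : ∀ x, T (-x) = T x) (hDt : ∀ x, convE (convE T T) Tt x ≤ Dt)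
    (hCT : ∀ x, C x * T x ≤ C x * Tt x) (hW : ∀ y, convE (fun s => C s * Tt s) T y ≤ W)
    (s : Bool) (p : X × X) :
    ∑' q, ∑' x, kB1 T Tt p q * (C (x - crd s q) * A3 T q.1 q.2 x) ≤ Dt * W := by
  have inner : ∀ q : X × X, ∑' x, C (x - crd s q) * A3 T q.1 q.2 x ≤ T (q.2 - q.1) * W := by
    intro q
    cases s with
    | true =>
      calc ∑' x, C (x - crd true q) * A3 T q.1 q.2 x
          = ∑' x, T (q.2 - q.1) * ((C (x - q.2) * T (x - q.2)) * T (x - q.1)) :=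
            tsum_congr fun x => by rw [crd_true, A3_def]; ring
        _ ≤ ∑' x, T (q.2 - q.1) * ((C (x - q.2) * Tt (x - q.2)) * T (x - q.1)) :=
            ENNReal.tsum_le_tsum fun x => mul_le_mul' le_rfl (mul_le_mul' (hCT _) le_rfl)
        _ = T (q.2 - q.1) * convE (fun s => C s * Tt s) T (q.1 - q.2) := by
            rw [ENNReal.tsum_mul_left, tsum_shift_mul_shift_eq_convE hTs (fun s => C s * Tt s) q.2 q.1]
        _ ≤ T (q.2 - q.1) * W := mul_le_mul' le_rfl (hW _)
    | false =>
      calc ∑' x, C (x - crd false q) * A3 T q.1 q.2 x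
          = ∑' x, T (q.2 - q.1) * ((C (x - q.1) * T (x - q.1)) * T (x - q.2)) :=
            tsum_congr fun x => by rw [crd_false, A3_def]; ring
        _ ≤ ∑' x, T (q.2 - q.1) * ((C (x - q.1) * Tt (x - q.1)) * T (x - q.2)) :=
            ENNReal.tsum_le_tsum fun x => mul_le_mul' le_rfl (mul_le_mul' (hCT _) le_rfl)
        _ = T (q.2 - q.1) * convE (fun s => C s * Tt s) T (q.2 - q.1) := by
            rw [ENNReal.tsum_mul_left, tsum_shift_mul_shift_eq_convE hTs (fun s => C s * Tt s) q.1 q.2]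
        _ ≤ T (q.2 - q.1) * W := mul_le_mul' le_rfl (hW _)
  calc ∑' q, ∑' x, kB1 T Tt p q * (C (x - crd s q) * A3 T q.1 q.2 x)
      = ∑' q, kB1 T Tt p q * ∑' x, C (x - crd s q) * A3 T q.1 q.2 x :=
        tsum_congr fun q => ENNReal.tsum_mul_left
    _ ≤ ∑' q, kB1 T Tt p q * (T (q.2 - q.1) * W) := ENNReal.tsum_le_tsum fun q => mul_le_mul' le_rfl (inner q)
    _ = (∑' z, ∑' t, Tt (t - p.2) * T (z - p.1) * T (t - z)) * W := by
        rw [← ENNReal.tsum_mul_right, ENNReal.tsum_prod']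
        refine tsum_congr fun z => ?_
        rw [← ENNReal.tsum_mul_right]
        exact tsum_congr fun t => by rw [kB1_def, B1_def]; ring
    _ ≤ Dt * W := mul_le_mul' (tsum_tsum_Tt_T_T_le hTs hDt p.1 p.2) le_rfl

/-- **(7.5.21), case (b), the weight on the `τ̃` line of `B₁`**: `Σ_u B̃₁(s,s+a₁,u,u+a₂) ≤ W_p(k)`.
[cite: HeydenreichVanDerHofstad2017, (7.5.19)–(7.5.21)] -/
theorem midB_true_le (hTs : ∀ x, T (-x) = T x) (hW : ∀ y, convE (fun s => C s * Tt s) T y ≤ W)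
    (r : X × X) (a : X) :
    ∑' z, C (crd true (z, z + a) - crd true r) * kB1 T Tt r (z, z + a) ≤ W := by
  calc ∑' z, C (crd true (z, z + a) - crd true r) * kB1 T Tt r (z, z + a)
      = ∑' z, (C (z - (r.2 - a)) * Tt (z - (r.2 - a))) * T (z - r.1) :=
        tsum_congr fun z => by
          simp only [crd_true, kB1_def, B1_def]
          rw [show z + a - r.2 = z - (r.2 - a) by abel]; ring
    _ = convE (fun s => C s * Tt s) T (r.1 - (r.2 - a)) :=
        tsum_shift_mul_shift_eq_convE hTs (fun s => C s * Tt s) (r.2 - a) r.1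
    _ ≤ W := hW _

/-- **(7.5.22)–(7.5.24), case (b), the weight on the `τ` line of `B₁`**:
`Σ_u B̃'₁(s,s+a₁,u,u+a₂) ≤ 2dp W_p(k)` (via (7.2.10) and `τ̃ = 2dp D ⋆ τ`).
[cite: HeydenreichVanDerHofstad2017, (7.5.22)–(7.5.24)] -/
theorem midB_false_le (hTs : ∀ x, T (-x) = T x) (hCT : ∀ x, C x * T x ≤ C x * Tt x)
    (hTt : ∀ x, Tt x = ∑' e, Jf e * T (x - e)) (hJ : ∑' e, Jf e ≤ J₀)
    (hW : ∀ y, convE (fun s => C s * Tt s) T y ≤ W) (r : X × X) (a : X) :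
    ∑' z, C (crd false (z, z + a) - crd false r) * kB1 T Tt r (z, z + a) ≤ J₀ * W := by
  calc ∑' z, C (crd false (z, z + a) - crd false r) * kB1 T Tt r (z, z + a)
      = ∑' z, (C (z - r.1) * T (z - r.1)) * Tt (z + a - r.2) :=
        tsum_congr fun z => by simp only [crd_false, kB1_def, B1_def]; ring
    _ ≤ ∑' z, (C (z - r.1) * Tt (z - r.1)) * Tt (z + a - r.2) :=
        ENNReal.tsum_le_tsum fun z => mul_le_mul' (hCT _) le_rfl
    _ = ∑' z, ∑' e, Jf e * ((C (z - r.1) * Tt (z - r.1)) * T (z - (r.2 + e - a))) := by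
        refine tsum_congr fun z => ?_
        rw [hTt (z + a - r.2), ← ENNReal.tsum_mul_left]
        exact tsum_congr fun e => by rw [show z + a - r.2 - e = z - (r.2 + e - a) by abel]; ring
    _ = ∑' e, Jf e * convE (fun s => C s * Tt s) T ((r.2 + e - a) - r.1) := by
        rw [ENNReal.tsum_comm]
        refine tsum_congr fun e => ?_
        rw [ENNReal.tsum_mul_left, tsum_shift_mul_shift_eq_convE hTs (fun s => C s * Tt s) r.1 (r.2 + e - a)]
    _ ≤ ∑' e, Jf e * W := ENNReal.tsum_le_tsum fun e => mul_le_mul' le_rfl (hW _)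
    _ ≤ J₀ * W := by rw [ENNReal.tsum_mul_right]; exact mul_le_mul' hJ le_rfl

/-- **(7.5.17), case (a), first line**: `sup_a Σ_{u,w,z} [1-cos(k·u)] A₃(0,u,w) B₁(w,u,z,z+a) ≤ Δ̃ W_p(k)`
(by translation invariance, as for the last line).
[cite: HeydenreichVanDerHofstad2017, (7.5.15)–(7.5.17) ("By symmetry")] -/
theorem startW_le (hTs : ∀ x, T (-x) = T x) (hTts : ∀ x, Tt (-x) = Tt x)
    (hDt : ∀ x, convE (convE T T) Tt x ≤ Dt) (hCT : ∀ x, C x * T x ≤ C x * Tt x)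
    (hW : ∀ y, convE (fun s => C s * Tt s) T y ≤ W) (a : X) :
    ∑' z, ∑' p, C p.2 * sA3 T p * kB1 T Tt p (z, z + a) ≤ Dt * W := by
  set G : X → ℝ≥0∞ := convE T Tt with hG
  calc ∑' z, ∑' p, C p.2 * sA3 T p * kB1 T Tt p (z, z + a)
      = ∑' p : X × X, C p.2 * sA3 T p * ∑' z, Tt (z + a - p.2) * T (z - p.1) := by
        rw [ENNReal.tsum_comm]
        refine tsum_congr fun p => ?_
        rw [← ENNReal.tsum_mul_left]
        exact tsum_congr fun z => by rw [kB1_def, B1_def]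
    _ = ∑' p : X × X, (C p.2 * T p.2) * (T p.1 * T (p.2 - p.1) * G (p.2 - a - p.1)) :=
        tsum_congr fun p => by rw [tsum_Tt_T_eq_convE hTts a p.2 p.1, sA3_def]; ring
    _ ≤ ∑' p : X × X, (C p.2 * Tt p.2) * (T p.1 * T (p.2 - p.1) * G (p.2 - a - p.1)) :=
        ENNReal.tsum_le_tsum fun p => mul_le_mul' (hCT _) le_rfl
    _ = ∑' u, (C u * Tt u) * ∑' w, T w * T (u - w) * G (u - a - w) := by
        rw [ENNReal.tsum_prod', ENNReal.tsum_comm]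
        exact tsum_congr fun u => by rw [← ENNReal.tsum_mul_left]
    _ = ∑' u, (C u * Tt u) * ∑' y, T (u - y) * T y * G (y - a) := by
        refine tsum_congr fun u => ?_
        rw [← tsum_comp_sub_left (fun w => T w * T (u - w) * G (u - a - w)) u]
        congr 1
        exact tsum_congr fun y => by rw [sub_sub_cancel, show u - a - (u - y) = y - a by abel]
    _ = ∑' y, T y * G (y - a) * ∑' u, (C u * Tt u) * T (u - y) := by
        rw [show (∑' u, (C u * Tt u) * ∑' y, T (u - y) * T y * G (y - a)) =
            ∑' u, ∑' y, (C u * Tt u) * (T (u - y) * T y * G (y - a)) from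
          tsum_congr fun u => by rw [← ENNReal.tsum_mul_left], ENNReal.tsum_comm]
        refine tsum_congr fun y => ?_
        rw [← ENNReal.tsum_mul_left]
        exact tsum_congr fun u => by ring
    _ = ∑' y, T y * G (y - a) * convE (fun s => C s * Tt s) T (y - 0) := by
        refine tsum_congr fun y => ?_
        rw [← tsum_shift_mul_shift_eq_convE hTs (fun s => C s * Tt s) 0 y]
        simp only [sub_zero]
    _ ≤ ∑' y, T y * G (y - a) * W := ENNReal.tsum_le_tsum fun y => mul_le_mul' le_rfl (hW _)
    _ ≤ Dt * W := by
        rw [ENNReal.tsum_mul_right]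
        exact mul_le_mul' (tsum_T_mul_G_le hTs hTts hDt a) le_rfl


/-- `triV` is translation invariant (subtractive form). [folklore] -/
theorem triV_shift_sub (s u t c : X) : triV T (s - c) (u - c) (t - c) = triV T s u t := by
  simpa only [sub_eq_add_neg] using triV_shift T s u t (-c)

/-- On the top line `t → w` of `B₂` the weight kills `B₂⁽²⁾` (`δ_{t,w} [1-cos(k·(w-t))] = 0`).
[cite: HeydenreichVanDerHofstad2017, §7.5.2 ("the third is constrained to vanish")] -/
theorem C_mul_kB2_top (hC0 : C 0 = 0) (q r : X × X) :
    C (r.1 - q.2) * kB2 T q r = C (r.1 - q.2) * B21 T q.1 q.2 r.1 r.2 := by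
  rw [kB2_def, B2_def, mul_add, B22_def]
  by_cases h : q.2 = r.1
  · rw [h, sub_self, hC0]; simp
  · rw [if_neg h]; simp

/-- The inner sum of case (c), `B₂⁽¹⁾`, top line weighted at its start:
`Σ_{w',u'} [1-cos]τ̃(w'-t₁) τ(u'-w') (τ⋆τ̃)(u'-a-w') τ(u'-z₁) ≤ W Δ̃`. [cite: HeydenreichVanDerHofstad2017, (7.5.29)] -/
theorem inner_c_true_le (hTs : ∀ x, T (-x) = T x) (hTts : ∀ x, Tt (-x) = Tt x)
    (hDt : ∀ x, convE (convE T T) Tt x ≤ Dt) (hW : ∀ y, convE (fun s => C s * Tt s) T y ≤ W)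
    (a z₁ t₁ : X) :
    ∑' r : X × X, (C (r.1 - t₁) * Tt (r.1 - t₁)) *
        (T (r.2 - r.1) * convE T Tt (r.2 - a - r.1) * T (r.2 - z₁)) ≤ Dt * W := by
  set G : X → ℝ≥0∞ := convE T Tt with hG
  set F : X → ℝ≥0∞ := fun s => C s * Tt s with hF
  calc ∑' r : X × X, (C (r.1 - t₁) * Tt (r.1 - t₁)) * (T (r.2 - r.1) * G (r.2 - a - r.1) * T (r.2 - z₁))
      = ∑' w', ∑' u', F (w' - t₁) * (T (u' - w') * G (u' - a - w') * T (u' - z₁)) := by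
        rw [ENNReal.tsum_prod']
    _ = ∑' w', ∑' y, F (w' - t₁) * (T y * G (y - a) * T (w' - (z₁ - y))) := by
        refine tsum_congr fun w' => ?_
        rw [← tsum_comp_add_right (fun u' => F (w' - t₁) * (T (u' - w') * G (u' - a - w') * T (u' - z₁))) w']
        exact tsum_congr fun y => by
          rw [add_sub_cancel_right, show y + w' - a - w' = y - a by abel,
            show y + w' - z₁ = w' - (z₁ - y) by abel]
    _ = ∑' y, T y * G (y - a) * ∑' w', F (w' - t₁) * T (w' - (z₁ - y)) := by
        rw [ENNReal.tsum_comm]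
        refine tsum_congr fun y => ?_
        rw [← ENNReal.tsum_mul_left]
        exact tsum_congr fun w' => by ring
    _ = ∑' y, T y * G (y - a) * convE F T ((z₁ - y) - t₁) :=
        tsum_congr fun y => by rw [tsum_shift_mul_shift_eq_convE hTs F t₁ (z₁ - y)]
    _ ≤ ∑' y, T y * G (y - a) * W := ENNReal.tsum_le_tsum fun y => mul_le_mul' le_rfl (hW _)
    _ ≤ Dt * W := by
        rw [ENNReal.tsum_mul_right]
        exact mul_le_mul' (tsum_T_mul_G_le hTs hTts hDt a) le_rfl

/-- The inner sum of case (c), `B₂⁽¹⁾`, the other top line weighted: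
`Σ_{w',u'} [1-cos]τ̃(u'-z₁) τ(w'-t₁) τ(u'-w') (τ⋆τ̃)(u'-a-w') ≤ W Δ̃`. [cite: HeydenreichVanDerHofstad2017, (7.5.29)] -/
theorem inner_c_false_le (hTs : ∀ x, T (-x) = T x) (hTts : ∀ x, Tt (-x) = Tt x)
    (hDt : ∀ x, convE (convE T T) Tt x ≤ Dt) (hW : ∀ y, convE (fun s => C s * Tt s) T y ≤ W)
    (a z₁ t₁ : X) :
    ∑' r : X × X, (C (r.2 - z₁) * Tt (r.2 - z₁)) *
        (T (r.1 - t₁) * T (r.2 - r.1) * convE T Tt (r.2 - a - r.1)) ≤ Dt * W := by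
  set G : X → ℝ≥0∞ := convE T Tt with hG
  set F : X → ℝ≥0∞ := fun s => C s * Tt s with hF
  calc ∑' r : X × X, (C (r.2 - z₁) * Tt (r.2 - z₁)) * (T (r.1 - t₁) * T (r.2 - r.1) * G (r.2 - a - r.1))
      = ∑' u', ∑' w', F (u' - z₁) * (T (w' - t₁) * T (u' - w') * G (u' - a - w')) := by
        rw [ENNReal.tsum_prod', ENNReal.tsum_comm]
    _ = ∑' u', ∑' y, F (u' - z₁) * (T (u' - (y + t₁)) * T y * G (y - a)) := by
        refine tsum_congr fun u' => ?_
        rw [← tsum_comp_sub_left (fun w' => F (u' - z₁) * (T (w' - t₁) * T (u' - w') * G (u' - a - w'))) u']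
        exact tsum_congr fun y => by
          rw [sub_sub_cancel, show u' - y - t₁ = u' - (y + t₁) by abel,
            show u' - a - (u' - y) = y - a by abel]
    _ = ∑' y, T y * G (y - a) * ∑' u', F (u' - z₁) * T (u' - (y + t₁)) := by
        rw [ENNReal.tsum_comm]
        refine tsum_congr fun y => ?_
        rw [← ENNReal.tsum_mul_left]
        exact tsum_congr fun u' => by ring
    _ = ∑' y, T y * G (y - a) * convE F T ((y + t₁) - z₁) :=
        tsum_congr fun y => by rw [tsum_shift_mul_shift_eq_convE hTs F z₁ (y + t₁)]
    _ ≤ ∑' y, T y * G (y - a) * W := ENNReal.tsum_le_tsum fun y => mul_le_mul' le_rfl (hW _)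
    _ ≤ Dt * W := by
        rw [ENNReal.tsum_mul_right]
        exact mul_le_mul' (tsum_T_mul_G_le hTs hTts hDt a) le_rfl

/-- **Case (c), the weight on the line `t → w` of `B₂`** (only `B₂⁽¹⁾` contributes):
`sup_{p,a} Σ_z midC(true)(p,(z,z+a)) ≤ Δ̃² W_p(k)`. [cite: HeydenreichVanDerHofstad2017, (7.5.26) and (7.5.29)] -/
theorem midC_true_le (hTs : ∀ x, T (-x) = T x) (hTts : ∀ x, Tt (-x) = Tt x) (hC0 : C 0 = 0)
    (hCT : ∀ x, C x * T x ≤ C x * Tt x) (hDt : ∀ x, convE (convE T T) Tt x ≤ Dt)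
    (hW : ∀ y, convE (fun s => C s * Tt s) T y ≤ W) (p : X × X) (a : X) :
    ∑' z, midC T Tt C true p (z, z + a) ≤ Dt * Dt * W := by
  set G : X → ℝ≥0∞ := convE T Tt with hG
  calc ∑' z, midC T Tt C true p (z, z + a)
      = ∑' q, ∑' r, kB1 T Tt p q * (C (r.1 - q.2) * kB2 T q r) * G (r.2 - a - r.1) := by
        calc ∑' z, midC T Tt C true p (z, z + a)
            = ∑' q, ∑' z, ∑' r, kB1 T Tt p q * (C (crd false r - crd true q) * kB2 T q r) *
                kB1 T Tt r (z, z + a) := by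
              simp only [midC_def, Bool.not_true]
              exact ENNReal.tsum_comm
          _ = ∑' q, ∑' r, ∑' z, kB1 T Tt p q * (C (crd false r - crd true q) * kB2 T q r) *
                kB1 T Tt r (z, z + a) := tsum_congr fun q => ENNReal.tsum_comm
          _ = _ := by
              refine tsum_congr fun q => tsum_congr fun r => ?_
              rw [ENNReal.tsum_mul_left, crd_false, crd_true, hG, ← tsum_Tt_T_eq_convE hTts a r.2 r.1]
              exact congrArg _ (tsum_congr fun z => by rw [kB1_def, B1_def])
    _ = ∑' q : X × X, ∑' r : X × X, (Tt (q.2 - p.2) * T (q.1 - p.1) * T (q.2 - q.1)) *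
          ((C (r.1 - q.2) * T (r.1 - q.2)) * (T (r.2 - r.1) * G (r.2 - a - r.1) * T (r.2 - q.1))) := by
        refine tsum_congr fun q => tsum_congr fun r => ?_
        rw [C_mul_kB2_top hC0, kB1_def, B1_def, B21_def]
        ring
    _ ≤ ∑' q : X × X, ∑' r : X × X, (Tt (q.2 - p.2) * T (q.1 - p.1) * T (q.2 - q.1)) *
          ((C (r.1 - q.2) * Tt (r.1 - q.2)) * (T (r.2 - r.1) * G (r.2 - a - r.1) * T (r.2 - q.1))) :=
        ENNReal.tsum_le_tsum fun q => ENNReal.tsum_le_tsum fun r =>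
          mul_le_mul' le_rfl (mul_le_mul' (hCT _) le_rfl)
    _ ≤ ∑' q : X × X, (Tt (q.2 - p.2) * T (q.1 - p.1) * T (q.2 - q.1)) * (Dt * W) := by
        refine ENNReal.tsum_le_tsum fun q => ?_
        rw [ENNReal.tsum_mul_left]
        exact mul_le_mul' le_rfl (inner_c_true_le hTs hTts hDt hW a q.1 q.2)
    _ = (∑' z, ∑' t, Tt (t - p.2) * T (z - p.1) * T (t - z)) * (Dt * W) := by
        rw [ENNReal.tsum_mul_right, ENNReal.tsum_prod']
    _ ≤ Dt * (Dt * W) := mul_le_mul' (tsum_tsum_Tt_T_T_le hTs hDt p.1 p.2) le_rfl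
    _ = Dt * Dt * W := (mul_assoc _ _ _).symm

open Classical in
/-- **Case (c), the weight on the line `z → u` of `B₂`**: the `B₂⁽¹⁾` part is at most `Δ̃² W_p(k)`
and the `B₂⁽²⁾` part IS `H_p(u - w, a; k) ≤ H_p(k)` ((7.5.1), (7.5.27)).
[cite: HeydenreichVanDerHofstad2017, (7.5.26)–(7.5.29)] -/
theorem midC_false_le (hTs : ∀ x, T (-x) = T x) (hTts : ∀ x, Tt (-x) = Tt x)
    (hCT : ∀ x, C x * T x ≤ C x * Tt x) (hDt : ∀ x, convE (convE T T) Tt x ≤ Dt)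
    (hW : ∀ y, convE (fun s => C s * Tt s) T y ≤ W) (hH : ∀ a₁ a₂, Hat T Tt C a₁ a₂ ≤ H)
    (p : X × X) (a : X) :
    ∑' z, midC T Tt C false p (z, z + a) ≤ Dt * Dt * W + H := by
  set G : X → ℝ≥0∞ := convE T Tt with hG
  -- split `B₂ = B₂⁽¹⁾ + B₂⁽²⁾`
  have esplit : ∀ z, midC T Tt C false p (z, z + a) =
      (∑' q : X × X, ∑' r : X × X, kB1 T Tt p q * (C (r.2 - q.1) * B21 T q.1 q.2 r.1 r.2) *
          kB1 T Tt r (z, z + a)) +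
        ∑' q : X × X, ∑' r : X × X, kB1 T Tt p q * (C (r.2 - q.1) * B22 T q.1 q.2 r.1 r.2) *
          kB1 T Tt r (z, z + a) := by
    intro z
    rw [midC_def, ← tsum₂_add]
    refine tsum_congr fun q => tsum_congr fun r => ?_
    simp only [Bool.not_false, crd_true, crd_false, kB2_def, B2_def]
    ring
  rw [tsum_congr esplit, ENNReal.tsum_add]
  refine add_le_add ?_ ?_
  · -- the `B₂⁽¹⁾` part
    calc ∑' z, ∑' q : X × X, ∑' r : X × X, kB1 T Tt p q * (C (r.2 - q.1) * B21 T q.1 q.2 r.1 r.2) *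
            kB1 T Tt r (z, z + a)
        = ∑' q : X × X, ∑' r : X × X, kB1 T Tt p q * (C (r.2 - q.1) * B21 T q.1 q.2 r.1 r.2) *
            G (r.2 - a - r.1) := by
          calc _ = ∑' q : X × X, ∑' z, ∑' r : X × X, kB1 T Tt p q *
                (C (r.2 - q.1) * B21 T q.1 q.2 r.1 r.2) * kB1 T Tt r (z, z + a) := ENNReal.tsum_comm
            _ = ∑' q : X × X, ∑' r : X × X, ∑' z, kB1 T Tt p q *
                (C (r.2 - q.1) * B21 T q.1 q.2 r.1 r.2) * kB1 T Tt r (z, z + a) :=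
                tsum_congr fun q => ENNReal.tsum_comm
            _ = _ := by
                refine tsum_congr fun q => tsum_congr fun r => ?_
                rw [ENNReal.tsum_mul_left, hG, ← tsum_Tt_T_eq_convE hTts a r.2 r.1]
                exact congrArg _ (tsum_congr fun z => by rw [kB1_def, B1_def])
      _ = ∑' q : X × X, ∑' r : X × X, (Tt (q.2 - p.2) * T (q.1 - p.1) * T (q.2 - q.1)) *
            ((C (r.2 - q.1) * T (r.2 - q.1)) * (T (r.1 - q.2) * T (r.2 - r.1) * G (r.2 - a - r.1))) := by
          refine tsum_congr fun q => tsum_congr fun r => ?_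
          rw [kB1_def, B1_def, B21_def]
          ring
      _ ≤ ∑' q : X × X, ∑' r : X × X, (Tt (q.2 - p.2) * T (q.1 - p.1) * T (q.2 - q.1)) *
            ((C (r.2 - q.1) * Tt (r.2 - q.1)) * (T (r.1 - q.2) * T (r.2 - r.1) * G (r.2 - a - r.1))) :=
          ENNReal.tsum_le_tsum fun q => ENNReal.tsum_le_tsum fun r =>
            mul_le_mul' le_rfl (mul_le_mul' (hCT _) le_rfl)
      _ ≤ ∑' q : X × X, (Tt (q.2 - p.2) * T (q.1 - p.1) * T (q.2 - q.1)) * (Dt * W) := by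
          refine ENNReal.tsum_le_tsum fun q => ?_
          rw [ENNReal.tsum_mul_left]
          exact mul_le_mul' le_rfl (inner_c_false_le hTs hTts hDt hW a q.1 q.2)
      _ = (∑' z, ∑' t, Tt (t - p.2) * T (z - p.1) * T (t - z)) * (Dt * W) := by
          rw [ENNReal.tsum_mul_right, ENNReal.tsum_prod']
      _ ≤ Dt * (Dt * W) := mul_le_mul' (tsum_tsum_Tt_T_T_le hTs hDt p.1 p.2) le_rfl
      _ = Dt * Dt * W := (mul_assoc _ _ _).symm
  · -- the `B₂⁽²⁾` part is `H(p.2 - p.1, a)`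
    refine le_trans (le_of_eq ?_) (hH (p.2 - p.1) a)
    -- the summand after the collapse `t₁ = w'`
    set R : X → X → X → X → X → ℝ≥0∞ := fun z z₁ t₁ w' u' =>
      Tt (t₁ - p.2) * T (z₁ - p.1) * C (u' - z₁) * T (u' - z₁) * triV T w' z₁ u' *
        Tt (z + a - u') * T (z - w') with hR
    calc ∑' z, ∑' q : X × X, ∑' r : X × X, kB1 T Tt p q * (C (r.2 - q.1) * B22 T q.1 q.2 r.1 r.2) *
            kB1 T Tt r (z, z + a)
        = ∑' z, ∑' z₁, ∑' t₁, ∑' w', ∑' u', (if t₁ = w' then 1 else 0) * R z z₁ t₁ w' u' := by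
          refine tsum_congr fun z => ?_
          rw [ENNReal.tsum_prod']
          refine tsum_congr fun z₁ => tsum_congr fun t₁ => ?_
          rw [ENNReal.tsum_prod']
          refine tsum_congr fun w' => tsum_congr fun u' => ?_
          simp only [kB1_def, B1_def, B22_def, hR]
          ring
      _ = ∑' z, ∑' z₁, ∑' w', ∑' u', ∑' t₁, (if t₁ = w' then 1 else 0) * R z z₁ t₁ w' u' := by
          refine tsum_congr fun z => tsum_congr fun z₁ => ?_
          rw [ENNReal.tsum_comm]
          exact tsum_congr fun w' => ENNReal.tsum_comm
      _ = ∑' z, ∑' z₁, ∑' w', ∑' u', R z z₁ w' w' u' :=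
          tsum_congr fun z => tsum_congr fun z₁ => tsum_congr fun w' => tsum_congr fun u' =>
            tsum_delta_left w' fun t₁ => R z z₁ t₁ w' u'
      _ = ∑' z₁, ∑' z, ∑' w', ∑' u', R z z₁ w' w' u' := ENNReal.tsum_comm
      _ = Hat T Tt C (p.2 - p.1) a := by
          rw [Hat_def, ← tsum_comp_sub_right (fun u₀ => ∑' v, ∑' s, ∑' t, C (t - u₀) *
            B1 T Tt 0 (p.2 - p.1) u₀ s * B22 T u₀ s s t * B1 T Tt s t v (v + a)) p.1]
          refine tsum_congr fun z₁ => ?_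
          rw [← tsum_comp_sub_right (fun v => ∑' s, ∑' t, C (t - (z₁ - p.1)) *
            B1 T Tt 0 (p.2 - p.1) (z₁ - p.1) s * B22 T (z₁ - p.1) s s t * B1 T Tt s t v (v + a)) p.1]
          refine tsum_congr fun z => ?_
          rw [← tsum_comp_sub_right (fun s => ∑' t, C (t - (z₁ - p.1)) *
            B1 T Tt 0 (p.2 - p.1) (z₁ - p.1) s * B22 T (z₁ - p.1) s s t *
              B1 T Tt s t (z - p.1) (z - p.1 + a)) p.1]
          refine tsum_congr fun w' => ?_
          rw [← tsum_comp_sub_right (fun t => C (t - (z₁ - p.1)) *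
            B1 T Tt 0 (p.2 - p.1) (z₁ - p.1) (w' - p.1) * B22 T (z₁ - p.1) (w' - p.1) (w' - p.1) t *
              B1 T Tt (w' - p.1) t (z - p.1) (z - p.1 + a)) p.1]
          refine tsum_congr fun u' => ?_
          simp only [hR, B1_def, B22_def, ite_true, sub_sub_sub_cancel_right, sub_zero, triV_shift_sub]
          rw [show z - p.1 + a - (u' - p.1) = z + a - u' by abel]
          ring


/-! #### Assembly: Prop. 7.4 in abstract form -/

/-- `Σ_{a,x} Θ_m((0,a),x) ≤ Δ (2Δ̃Δ)^m` (Exercise 7.5 iterated). [cite: HeydenreichVanDerHofstad2017, Exercise 7.5 and (7.5.9)] -/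
theorem bwd_le (hTs : ∀ x, T (-x) = T x) (hTts : ∀ x, Tt (-x) = Tt x)
    (hD : ∀ x, convE (convE T T) T x ≤ D) (hDt : ∀ x, convE (convE T T) Tt x ≤ Dt) :
    ∀ m : ℕ, bwd T Tt m ≤ D * (2 * Dt * D) ^ m
  | 0 => by rw [pow_zero, mul_one]; exact bwd_zero_le hTs hD
  | m + 1 => by
    have hS : ∀ a', ∑' z, ∑' a, ∑' q, kB2 T (0, a) q * kB1 T Tt q (z, z + a') ≤ 2 * Dt * D :=
      fun a' => (bwd_block_le hTs hTts hD hDt a').trans_eq (by ring)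
    calc bwd T Tt (m + 1) ≤ (2 * Dt * D) * bwd T Tt m := bwd_succ_le T Tt m hS
      _ ≤ (2 * Dt * D) * (D * (2 * Dt * D) ^ m) := mul_le_mul' le_rfl (bwd_le hTs hTts hD hDt m)
      _ = D * (2 * Dt * D) ^ (m + 1) := by rw [pow_succ]; ring

/-- **Prop. 7.4, (7.5.3), abstract**: `Σ_x [rhs of (7.4.10) for Π^{(n+1)}] ≤ Δ (2Δ̃Δ)^{n+1}`.
[cite: HeydenreichVanDerHofstad2017, Prop. 7.4 (7.5.3), §7.5.1] -/
theorem tsum_chainN_le_closed (hT0 : T 0 = 1) (hTs : ∀ x, T (-x) = T x) (hTts : ∀ x, Tt (-x) = Tt x)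
    (hD : ∀ x, convE (convE T T) T x ≤ D) (hDt : ∀ x, convE (convE T T) Tt x ≤ Dt) (n : ℕ) :
    ∑' x, chainN T Tt n x ≤ D * (2 * Dt * D) ^ (n + 1) := by
  have hS : ∀ p, ∑' q, ∑' r, kB1 T Tt p q * kB2 T q r ≤ 2 * Dt * D :=
    fun p => (fwd_block_le hTs hTts hD hDt p).trans_eq (by ring)
  have hE : ∀ p, ∑' q, ∑' x, kB1 T Tt p q * A3 T q.1 q.2 x ≤ 2 * Dt * D := fun p =>
    (end_block_le hT0 hTs hTts hD hDt p).trans (by rw [two_mul, add_mul, mul_comm D Dt]; exact le_self_add)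
  calc ∑' x, chainN T Tt n x ≤ mass (sA3 T) * (2 * Dt * D) ^ n * (2 * Dt * D) := tsum_chainN_le T Tt hS hE n
    _ ≤ D * (2 * Dt * D) ^ n * (2 * Dt * D) := by gcongr; exact mass_sA3_le hTs hD
    _ = D * (2 * Dt * D) ^ (n + 1) := by rw [pow_succ]; ring

/-- The closed form of the recursive bound `Bd`. [cite: HeydenreichVanDerHofstad2017, §7.5.2] -/
theorem Bd_le {Wa Wb Wc : Bool → ℝ≥0∞} {S wa wb wc : ℝ≥0∞} (hWa : ∀ s, Wa s ≤ wa)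
    (hWb : ∀ s, Wb s ≤ wb) (hWc : ∀ s, Wc s ≤ wc) (hbwd : ∀ m, bwd T Tt m ≤ D * S ^ m) :
    ∀ (m : ℕ) (s : Bool), Bd T Tt Wa Wb Wc S m s ≤ m * D * S ^ (m - 1) * (wc + S * wb) + S ^ m * wa
  | 0, s => by
    rw [Bd_zero, Nat.cast_zero, zero_mul, zero_mul, zero_mul, zero_add, pow_zero, one_mul]
    exact hWa s
  | 1, s => by
    rw [Bd_succ, Bd_zero]
    calc Wc s * bwd T Tt 0 + S * Wb (!s) * bwd T Tt 0 + S * Wa (!s)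
        ≤ wc * (D * S ^ 0) + S * wb * (D * S ^ 0) + S * wa := by
          gcongr
          · exact hWc s
          · exact hbwd 0
          · exact hWb (!s)
          · exact hbwd 0
          · exact hWa (!s)
      _ = _ := by simp only [Nat.cast_one, pow_zero, pow_one, Nat.sub_self]; ring
  | m + 2, s => by
    rw [Bd_succ]
    have ih := Bd_le hWa hWb hWc hbwd (m + 1) (!s)
    rw [Nat.add_sub_cancel] at ih
    calc Wc s * bwd T Tt (m + 1) + S * Wb (!s) * bwd T Tt (m + 1) + S * Bd T Tt Wa Wb Wc S (m + 1) (!s)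
        ≤ wc * (D * S ^ (m + 1)) + S * wb * (D * S ^ (m + 1)) +
          S * ((m + 1 : ℕ) * D * S ^ m * (wc + S * wb) + S ^ (m + 1) * wa) := by
          gcongr
          · exact hWc s
          · exact hbwd (m + 1)
          · exact hWb (!s)
          · exact hbwd (m + 1)
      _ = _ := by
          have e : m + 2 - 1 = m + 1 := by omega
          simp only [Nat.cast_add, Nat.cast_one, Nat.cast_ofNat, e]
          ring

/-- **Prop. 7.4, (7.5.4), abstract**: for the right-hand side of (7.4.10) bounding `Π^{(n+1)}`,
`Σ_x [1-cos(k·x)] (…) ≤ (2(n+1)+1) [2 Δ Δ̃ W P^n + (n+1)(1 + ΣJ) Δ² W P^n + n (Δ̃² W + H) Δ² P^{n-1}]`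
with `P = 2 Δ̃ Δ` (the printed `Δ W (2Δ̃ + [1+2dp] N Δ) P^{N-1} + (N-1)(Δ̃² W + H) Δ² P^{N-2}`, `N = n+1`).
[cite: HeydenreichVanDerHofstad2017, Prop. 7.4 (7.5.4), §7.5.2] -/
theorem tsum_cos_chainN_le_closed (hT0 : T 0 = 1) (hTs : ∀ x, T (-x) = T x) (hTts : ∀ x, Tt (-x) = Tt x)
    (hCl : ∀ L : List X, C L.sum ≤ L.length * (L.map C).sum) (hC0 : C 0 = 0)
    (hCT : ∀ x, C x * T x ≤ C x * Tt x) (hTt : ∀ x, Tt x = ∑' e, Jf e * T (x - e)) (hJ : ∑' e, Jf e ≤ J₀)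
    (hD : ∀ x, convE (convE T T) T x ≤ D) (hDt : ∀ x, convE (convE T T) Tt x ≤ Dt)
    (hW : ∀ y, convE (fun s => C s * Tt s) T y ≤ W) (hH : ∀ a₁ a₂, Hat T Tt C a₁ a₂ ≤ H) (n : ℕ) :
    ∑' x, C x * chainN T Tt n x ≤ (2 * n + 3 : ℝ≥0∞) *
      (2 * D * Dt * W * (2 * Dt * D) ^ n + (n + 1) * (1 + J₀) * D ^ 2 * W * (2 * Dt * D) ^ n +
        n * (Dt ^ 2 * W + H) * D ^ 2 * (2 * Dt * D) ^ (n - 1)) := by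
  have _ := hT0
  set S : ℝ≥0∞ := 2 * Dt * D with hSdef
  have hS : ∀ p, ∑' q, ∑' r, kB1 T Tt p q * kB2 T q r ≤ S :=
    fun p => (fwd_block_le hTs hTts hD hDt p).trans_eq (by rw [hSdef]; ring)
  set Wa : Bool → ℝ≥0∞ := fun _ => Dt * W with hWadef
  set Wb : Bool → ℝ≥0∞ := fun s => cond s W (J₀ * W) with hWbdef
  set Wc : Bool → ℝ≥0∞ := fun s => cond s (Dt * Dt * W) (Dt * Dt * W + H) with hWcdef
  have hWa : ∀ s p, ∑' q, ∑' x, kB1 T Tt p q * (C (x - crd s q) * A3 T q.1 q.2 x) ≤ Wa s :=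
    fun s p => endW_le hTs hDt hCT hW s p
  have hWb : ∀ s (r : X × X) (a : X),
      ∑' z, C (crd s (z, z + a) - crd s r) * kB1 T Tt r (z, z + a) ≤ Wb s := by
    intro s r a
    cases s with
    | true => simpa only [hWbdef, cond_true] using midB_true_le hTs hW r a
    | false => simpa only [hWbdef, cond_false] using midB_false_le hTs hCT hTt hJ hW r a
  have hWc : ∀ s (p : X × X) (a : X), ∑' z, midC T Tt C s p (z, z + a) ≤ Wc s := by
    intro s p a
    cases s with
    | true => simpa only [hWcdef, cond_true] using midC_true_le hTs hTts hC0 hCT hDt hW p a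
    | false => simpa only [hWcdef, cond_false] using midC_false_le hTs hTts hCT hDt hW hH p a
  have hW8 : ∀ a, ∑' z, ∑' p, C p.2 * sA3 T p * kB1 T Tt p (z, z + a) ≤ Dt * W :=
    fun a => startW_le hTs hTts hDt hCT hW a
  have hmain := tsum_cos_chainN_le T Tt C hCl hS hWa hWb hWc hW8 n
  have hbwd := bwd_le hTs hTts hD hDt
  have hmass := mass_sA3_le hTs hD
  have hBd := Bd_le (Wa := Wa) (Wb := Wb) (Wc := Wc) (S := S) (wa := Dt * W) (wb := (1 + J₀) * W)
    (wc := Dt * Dt * W + H) (fun _ => le_rfl)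
    (fun s => by
      cases s with
      | true =>
        simp only [hWbdef, cond_true]
        calc W = 1 * W := (one_mul W).symm
          _ ≤ (1 + J₀) * W := mul_le_mul' le_self_add le_rfl
      | false =>
        simp only [hWbdef, cond_false]
        exact mul_le_mul' le_add_self le_rfl)
    (fun s => by
      cases s with
      | true => simp only [hWcdef, cond_true]; exact le_self_add
      | false => simp only [hWcdef, cond_false]; exact le_rfl)
    hbwd n true
  -- the three pieces
  have h1 : Dt * W * bwd T Tt n + mass (sA3 T) * (S ^ n * (Dt * W)) ≤ 2 * D * Dt * W * S ^ n := by
    calc Dt * W * bwd T Tt n + mass (sA3 T) * (S ^ n * (Dt * W))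
        ≤ Dt * W * (D * S ^ n) + D * (S ^ n * (Dt * W)) := by gcongr; exact hbwd n
      _ = 2 * D * Dt * W * S ^ n := by ring
  have h2 : mass (sA3 T) * Wb true * bwd T Tt n + mass (sA3 T) * (n * D * S ^ (n - 1) * (S * ((1 + J₀) * W))) ≤
      (n + 1) * (1 + J₀) * D ^ 2 * W * S ^ n := by
    have hWbt : Wb true = W := by simp only [hWbdef, cond_true]
    rw [hWbt]
    calc mass (sA3 T) * W * bwd T Tt n + mass (sA3 T) * (n * D * S ^ (n - 1) * (S * ((1 + J₀) * W)))
        ≤ D * W * (D * S ^ n) + D * (n * D * S ^ (n - 1) * (S * ((1 + J₀) * W))) := by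
          gcongr; exact hbwd n
      _ ≤ _ := by
          cases n with
          | zero =>
            simp only [Nat.cast_zero, zero_mul, mul_zero, add_zero, zero_add, pow_zero, mul_one, one_mul]
            calc D * W * D = 1 * (D ^ 2 * W) := by ring
              _ ≤ (1 + J₀) * (D ^ 2 * W) := mul_le_mul' le_self_add le_rfl
              _ = (1 + J₀) * D ^ 2 * W := by ring
          | succ k =>
            simp only [Nat.cast_add, Nat.cast_one, Nat.add_sub_cancel]
            calc D * W * (D * S ^ (k + 1)) + D * ((k + 1) * D * S ^ k * (S * ((1 + J₀) * W)))
                = 1 * (D ^ 2 * W * S ^ (k + 1)) + (k + 1) * (1 + J₀) * D ^ 2 * W * S ^ (k + 1) := by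
                  rw [pow_succ]; ring
              _ ≤ (1 + J₀) * (D ^ 2 * W * S ^ (k + 1)) + (k + 1) * (1 + J₀) * D ^ 2 * W * S ^ (k + 1) :=
                  add_le_add (mul_le_mul' le_self_add le_rfl) le_rfl
              _ = (k + 1 + 1) * (1 + J₀) * D ^ 2 * W * S ^ (k + 1) := by ring
  have h3 : mass (sA3 T) * (n * D * S ^ (n - 1) * (Dt * Dt * W + H)) ≤
      n * (Dt ^ 2 * W + H) * D ^ 2 * S ^ (n - 1) := by
    calc mass (sA3 T) * (n * D * S ^ (n - 1) * (Dt * Dt * W + H))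
        ≤ D * (n * D * S ^ (n - 1) * (Dt * Dt * W + H)) := mul_le_mul' hmass le_rfl
      _ = n * (Dt ^ 2 * W + H) * D ^ 2 * S ^ (n - 1) := by ring
  calc ∑' x, C x * chainN T Tt n x ≤ (2 * n + 3 : ℝ≥0∞) *
        (Dt * W * bwd T Tt n + mass (sA3 T) * Wb true * bwd T Tt n +
          mass (sA3 T) * Bd T Tt Wa Wb Wc S n true) := hmain
    _ ≤ (2 * n + 3 : ℝ≥0∞) * (Dt * W * bwd T Tt n + mass (sA3 T) * Wb true * bwd T Tt n +
          mass (sA3 T) * (n * D * S ^ (n - 1) * (Dt * Dt * W + H + S * ((1 + J₀) * W)) + S ^ n * (Dt * W))) := by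
        gcongr
    _ = (2 * n + 3 : ℝ≥0∞) * ((Dt * W * bwd T Tt n + mass (sA3 T) * (S ^ n * (Dt * W))) +
          (mass (sA3 T) * Wb true * bwd T Tt n +
            mass (sA3 T) * (n * D * S ^ (n - 1) * (S * ((1 + J₀) * W)))) +
          mass (sA3 T) * (n * D * S ^ (n - 1) * (Dt * Dt * W + H))) := by ring
    _ ≤ (2 * n + 3 : ℝ≥0∞) * (2 * D * Dt * W * S ^ n + (n + 1) * (1 + J₀) * D ^ 2 * W * S ^ n +
          n * (Dt ^ 2 * W + H) * D ^ 2 * S ^ (n - 1)) := by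
        gcongr (2 * n + 3 : ℝ≥0∞) * ?_
        exact add_le_add (add_le_add h1 h2) h3

end Estimates

end DiagramAlgebra

end Literature.Barriers.CriticalPhenomena

end
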